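import Literature.Analysis.ValidatedNumerics.PeriodicTrapezoidCert
import Literature.Analysis.Quadrature.GaussLegendreAnalytic
import Literature.Analysis.SpecialFunctions.LegendreDifferentialRelation
import Literature.Analysis.ValidatedNumerics.SignChangeRootIsolation
import HarnessLib

/-!
# Kernel-checked Gauss–Legendre quadrature certificates: enclosures of `∫ₐᵇ f(t) dt` for integrands
# analytic on a Bernstein ellipse, by one `decide`

Trunk T-ANA (Analysis/ValidatedNumerics); namespace `Literature.Analysis.ValidatedNumerics.GaussLegendre`.
Sequel of `Literature/Analysis/Quadrature/GaussLegendreAnalytic.lean` (the ANALYSIS, proved there once and for all: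
if `f` is holomorphic on the open Bernstein ellipse `E_ρ` of `[a, b]`, continuous on its closure and bounded by `M`
there, the `N`-point Gauss–Legendre rule satisfies `‖∫ₐᵇ f − Σ λ_k f(x_k)‖ ≤ (b−a)/2 · 8M/((ρ−1)ρ^{2N−1})`,
`norm_integral_sub_gaussLegendre_le_interval` — Trefethen, Thm. 4.5, in the `64/15 → 4` form; Petras's estimate
(2); the bound `M ρ^{−2n} C_ρ` of Johansson's Sect. 2), of `SignChangeRootIsolation.lean` (disjoint sign-change
brackets isolate ALL the nodes: `existsUnique_gaussLegendreNode_mem_Icc`, `exists_gaussLegendreNode_mem_Ioo`), of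
`LegendreDifferentialRelation.lean` (Bonnet's recursion `eval_legendre_add_two`; the weight formula in terms of
`P_{N−1}`, `gaussLegendreWeight_eq_of_legendre_pred`: `λ_x = 2(1 − x²)/(N² P_{N−1}(x)²)`), and of
`PeriodicTrapezoidCert.lean` / `MultiPrecisionInterval.lean` (outward-rounded integer interval arithmetic `MI`/`MC`
at a scale `S` with the kernels `MI.exp`, `MI.pi`, `MC.expI`, the self-validating `sqrtI`, `invI`, and `expUb`).
THE PROBLEM (Petras, Sect. 3; Johansson, Sect. 2): Gauss–Legendre quadrature converges geometrically for
integrands analytic in a neighbourhood of `[a, b]`, with an EXPLICIT error bound once an ellipse parameter `ρ` and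
a bound `M` of `|f|` on `E_ρ` are known; a CERTIFICATE needs (i) a certified `M` — including the guarantee that
the continuation of `f` IS holomorphic on the ellipse (no zero of a denominator, no branch point of a root) —,
(ii) certified NODES AND WEIGHTS, which are irrational algebraic numbers (the rigorous integrators of Petras and of
Arb tabulate or compute them in ball arithmetic, outside any proof kernel), and (iii) a rigorous evaluation of the
finite sum.  This module supplies all three, for a code list of integrands, so that ONE `decide` proves
`∫ₐᵇ f ∈ [lo, hi]`; it completes the kernel-quadrature trio of this directory (periodic: `PeriodicTrapezoidCert`;
real line: `RealLineTrapezoidCert`; finite interval: here).  Four parts: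

* Part A — SYNTAX AND SEMANTICS: `EExpr` (the variable, rational constants, rational scaling, `+ − ×`, natural
  powers, `exp cos sin ⁻¹ √`), complex semantics `evalC` (principal `√`), real semantics `evalR`, the ellipse
  `ell ρ a b = {z | |z−a| + |z−b| < (ρ + ρ⁻¹)(b−a)/2}` (literally the anchor's set) and `ofReal_mem_ell`.
* Part B — THE CERTIFIED ELLIPSE MAJORANT, a rational "ellipse-bound arithmetic" `ebnd ρ a b e : EB =
  (ub, lb, relo, rehi, imlo, imhi)` propagating, for the value `w` of every subexpression over the CLOSED
  ellipse, bounds `lb ≤ |w| ≤ ub`, `relo ≤ Re w ≤ rehi`, `imlo ≤ Im w ≤ imhi`: the variable lives in Petras's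
  rectangle `|Re z − m| ≤ h(ρ + ρ⁻¹)/2`, `|Im z| ≤ h(ρ − ρ⁻¹)/2` (`m`, `h` = midpoint, half-length); products by
  corner hulls; `|e^w| ≤ (68/25)^⌈rehi⌉`; `|cos w|, |sin w| ≤ cosh(max |Im w|)`; `|w⁻¹| ≤ 1/lb`; `|√w| ≤
  (1 + |w|)/2`, `Re √w ≥ 0`; the side conditions `eok ρ a b e` (every reciprocal has `lb > 0`, every radicand
  `relo > 0`, decided over `ℚ`) make the continuation holomorphic: `ebnd_evalC` (ONE induction: `eok → z ∈ ell →
  EBnd (evalC e z) (ebnd ρ a b e) ∧ DifferentiableAt ℂ (evalC e) z`), `differentiableOn_evalC`, `norm_evalC_le`,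
  `evalC_ofReal` (on `[a, b]` the complex semantics is the real one).
* Part C — THE ERROR THEOREM `abs_integral_sub_gl_le` (`1 < ρ`, `a < b`, `eok`): `|∫ₐᵇ evalR e −
  Σ_{x ∈ nodes (n+1)} (b−a)/2 · λ_x · evalR e ((b−a)/2·x + (a+b)/2)| ≤ (b−a)/2 · 8·ub/((ρ−1) ρ^{2n+1})`, the
  anchor instantiated with `M = (ebnd ρ a b e).ub` and transported to `ℝ`.
* Part D — THE KERNEL.  Nodes: a candidate `c : ℤ` names the bracket `[(c−1)/T, (c+1)/T]`; `legInt` evaluates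
  `T^{N} N! P_N` at both ends EXACTLY in `ℤ` (Bonnet's recursion cleared of denominators) and the bracket is
  accepted iff the signs differ; `n+1` accepted, pairwise separated brackets isolate exactly the `n+1` nodes
  (Part D never trusts where the candidates came from).  Weights: `legPair` runs Bonnet's recursion in interval
  arithmetic on the bracket (scale `bscale T = 2¹⁰ T`) and encloses `λ_x` by the `P_{N−1}` formula (`MI.divPos`
  certifies the denominator).  Integrand: `evalI` (`MI.exp`, `MC.expI` with the enclosure `MI.pi` of `π` for
  `cos`/`sin`, `invI`, `sqrtI`, `powI`), `mem_evalI`.  Sum: `glTerm`/`glSum` (`glTerm_spec`, `glSum_spec`), data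
  `glData`, error radius `errQ`; the Boolean CERTIFICATE `glCheckD e a b ρ n S T K k cs lo hi` (integer arithmetic
  only) and MAIN THEOREM `integral_mem_of_glCheckD : glCheckD … = true → ∫ t in a..b, evalR e t ∈ Set.Icc lo hi`,
  hypothesis-free but for the Boolean, which the kernel decides (the bijection between brackets and nodes is
  `Finset.sum_nbij` over the isolation theorems).  Finally the UNTRUSTED node search `glCands n T` (Newton's
  method on `P_N` in truncating integer arithmetic with `2n+16` guard bits from the Chebyshev-type guesses
  `cos(π(4i+3)/(4N+2))`, rounded to scale `T`; `#eval` it and paste, or let the kernel run it) and the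
  self-contained `glCheck … := glCheckD … (glCands n T) …` with `integral_mem_of_glCheck`.

Parameters (all chosen by the untrusted proposer; any values that pass are sound): `ρ` just below the parameter
of the largest ellipse free of singularities AS SEEN BY THE MAJORANT CALCULUS (Part B works with rectangles and
corner hulls, so e.g. `1/(1+t²)` on `[0,1]` passes `eok` for `ρ ≤ 3` although the poles `±i` allow `ρ < 4.6`; a too
large `ρ` simply fails `eok`); the error radius `errQ = (b−a)/2 · 8·ub/((ρ−1)ρ^{2n+1})` gains `2 log₁₀ ρ` digits
per node; the sum scale `S ≈ 10^{digits+4}`; the bracket scale `T ≈ S · 2^{3n/2+10}` (interval dependency in the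
degree-`n` recursion on a bracket of width `2/T` costs about `1.3 n` bits of the weight enclosure; a too small `T`
only widens the result); `K` Taylor / Machin terms (`K ≥ 0.22 log₂ S` if the integrand contains `cos`/`sin`,
else `(2.5/2^k)^K/K! < 2^{−log₂ S}` suffices), `k ≈ 8` argument halvings.  Kernel cost: `O(n²)` interval
operations for the weights plus `n+1` integrand evaluations — seconds, not minutes: the five certificates below
took `7–12 s` each on the farm on top of the `11 s` of this module.

Worked end to end (scratch kept OUT of the tree, `Certquad.ScratchGaussLegendre`, four files on top of this
module, `18 + 32 + 25 + 18 s` on the farm including the module each time), each by ONE `decide +kernel` of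
`glCheckD` (node candidates pasted from `#eval glCands n T`) followed by `simp only [evalR]; push_cast` to display
the integrand: `∫₀¹ e^{−t²} dt` (entire; `ρ = 8`, `n+1 = 40`, `S = 2²⁴⁰`, `T = 2³⁰⁰`, `K = 28`) to width
`9.3·10⁻⁶⁹`; `∫₀¹ dt/(1+t²)` (`= π/4`; poles `±i`; `ρ = 3`, `n+1 = 53`, `S = 2¹⁷⁰`) to `3.7·10⁻⁴⁹`; `∫₁² eᵗ/t dt`
(`= Ei 2 − Ei 1`; pole `0`; `ρ = 5`, `n+1 = 45`, `S = 2²¹⁶`) to `1.5·10⁻⁶⁰`; `∫₀¹ cos(t²) dt` (entire, argument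
reduction by `MI.pi`; `ρ = 8`, `n+1 = 31`, `S = 2¹⁹⁰`, `K = 44`) to `5.8·10⁻⁵³`; `∫₀¹ √(1+t²) dt` (`= (√2 +
asinh 1)/2`; branch points `±i`; `ρ = 3`, `n+1 = 45`, `S = 2¹⁵⁰`) to `2.7·10⁻⁴²`; and, by the SELF-CONTAINED
`glCheck` (Newton's node search run inside the kernel, nothing pasted), `∫₀¹ e^{−t²} dt` again with `n+1 = 25`,
`S = 2¹⁵⁰` to `7.9·10⁻⁴²` in `7 s`.  The closed forms are NOT used or proved; reference values computed
independently (Python `Decimal`, 110 digits: the series `Σ(−1)^k/(k!(2k+1))`, Machin, `ln 2 + Σ(2^k−1)/(k·k!)`,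
`Σ(−1)^k/((2k)!(4k+1))`, `(√2 + ln(1+√2))/2`) lie inside every bracket.

Honest framing.  These are shared numerical engines serving client cells; rigour lives in the verifiers (the
soundness theorems below, whose only hypothesis is a Boolean certificate decided by the kernel); every published
number belongs to a client cell's ledger, not to the engines group.  ANCHOR / nearest in-tree relatives:
`Quadrature.GaussLegendreAnalytic` (USED: `norm_integral_sub_gaussLegendre_le_interval` — all the complex
analysis is there), `SpecialFunctions.GaussLegendreQuadrature` / `LegendreDifferentialRelation` /
`LegendrePolynomials` (USED: nodes, weights, Bonnet, the `P_{N−1}` weight formula),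
`ValidatedNumerics.SignChangeRootIsolation` (USED: node isolation from sign changes), `MultiPrecisionInterval` and
`PeriodicTrapezoidCert` (USED: `MI`/`MC` kernels, `sqrtI`, `invI`, `expUb`; the periodic sibling),
`RealLineTrapezoidCert` (the real-line sibling, not imported), `TaylorModelIntegralCert*` (algebraic order).
Nearest prior art in print: Petras's self-validating integrator (Gaussian formulas up to `Q₁₂₈` STORED, `M` from
complex interval evaluation on a rectangle around the ellipse), the Petras–Johansson integrator of Arb (adaptive
degree and bisection, nodes computed at run time in ball arithmetic by the Johansson–Mezzarobba algorithm), and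
CoqInterval's formally verified quadrature (polynomial approximation, algebraic order); none produces a
proof-kernel object for Gauss–Legendre, and here every node is re-certified inside the kernel by an exact integer
sign test, the weight by an interval evaluation of a proved closed formula, and `M` by a symbolic rational
majorant calculus, so the error term is a closed-form rational.  Deliberately NOT here: adaptivity (bisection,
the choice of `ρ`, `n` — the proposer's business; a panel split is two certificates and
`intervalIntegral.integral_add_adjacent_intervals`), endpoint singularities, integrands outside the code list
(`log`, general powers, special functions: add a constructor with its `EBnd` and `evalI` clauses), complex-valued
integrals, sharper majorants (true ellipse images instead of rectangles), and any floating-point arithmetic (all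
certificate data are exact rationals and scaled integers).  Problem-independent; no facts, no axioms; all
certificate data computable over `ℚ` and `ℤ`.

References: [cite: Trefethen2008, Thm. 4.5]; [cite: Petras2002, Sect. 3 (2)]; [cite: Petras2002, Sect. 5.1];
[cite: Johansson2018, Sect. 2]; [cite: JohanssonMezzarobba2018, Sect. 7.2]; [cite: Szego1939, Thm. 3.3.1];
[cite: AbramowitzStegun1964, 25.4.29]; [cite: Jeffrey1995, §18.2.5.1 (1)]; [cite: Moore1979, Thm. 3.1];
[cite: Moore1979, Sect. 2.2]; [cite: Moore1979, Sect. 3.3]; [cite: Moore1979, Sect. 4.4 (4.11)];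
[cite: Moore1979, Sect. 4.4 (4.12)]; [cite: MahboubiMelquiondSibutpinote2016, Sect. 4.1].

AI-produced formalisation (H21 engines group, seat eng-quad-3 gen 62, 2026-08-23); no facts, no axioms, no `sorry`.
-/

open scoped Real

namespace Literature.Analysis.ValidatedNumerics

namespace GaussLegendre

open Literature.Analysis.ValidatedNumerics.NumericsMP
open Literature.Analysis.ValidatedNumerics.PeriodicTrapezoid (expUb sqrtI invI mem_sqrtI mem_invI)
open Literature.Analysis.SpecialFunctions (legendre gaussLegendreNodes gaussLegendreWeight)

/-! ### Part A. The integrand language: syntax, complex and real semantics -/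

/-- The integrand language: expressions in one variable `t` built from rational constants by
rational scaling, `+ − ×`, natural powers, `exp cos sin`, reciprocal and (principal) square root — a
code list in the sense of interval analysis. [cite: Moore1979, Sect. 4.4 (4.11)] -/
inductive EExpr : Type
  | var : EExpr
  | const (c : ℚ) : EExpr
  | scale (q : ℚ) (e : EExpr) : EExpr
  | add (e f : EExpr) : EExpr
  | sub (e f : EExpr) : EExpr
  | neg (e : EExpr) : EExpr
  | mul (e f : EExpr) : EExpr
  | pow (e : EExpr) (n : ℕ) : EExpr
  | exp (e : EExpr) : EExpr
  | cos (e : EExpr) : EExpr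
  | sin (e : EExpr) : EExpr
  | inv (e : EExpr) : EExpr
  | sqrt (e : EExpr) : EExpr
  deriving Repr

/-- Complex semantics (the analytic continuation of the integrand; `√` is the principal branch
`w ^ (1/2)`). [cite: Trefethen2008, Thm. 4.5] -/
noncomputable def evalC : EExpr → ℂ → ℂ
  | .var, z => z
  | .const c, _ => (c : ℂ)
  | .scale q e, z => (q : ℂ) * evalC e z
  | .add e f, z => evalC e z + evalC f z
  | .sub e f, z => evalC e z - evalC f z
  | .neg e, z => -evalC e z
  | .mul e f, z => evalC e z * evalC f z
  | .pow e n, z => evalC e z ^ n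
  | .exp e, z => Complex.exp (evalC e z)
  | .cos e, z => Complex.cos (evalC e z)
  | .sin e, z => Complex.sin (evalC e z)
  | .inv e, z => (evalC e z)⁻¹
  | .sqrt e, z => evalC e z ^ (((1 : ℝ) / 2 : ℝ) : ℂ)

/-- Real semantics: the integrand `f(t)`. [cite: Trefethen2008, Thm. 4.5] -/
noncomputable def evalR : EExpr → ℝ → ℝ
  | .var, t => t
  | .const c, _ => (c : ℝ)
  | .scale q e, t => (q : ℝ) * evalR e t
  | .add e f, t => evalR e t + evalR f t
  | .sub e f, t => evalR e t - evalR f t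
  | .neg e, t => -evalR e t
  | .mul e f, t => evalR e t * evalR f t
  | .pow e n, t => evalR e t ^ n
  | .exp e, t => Real.exp (evalR e t)
  | .cos e, t => Real.cos (evalR e t)
  | .sin e, t => Real.sin (evalR e t)
  | .inv e, t => (evalR e t)⁻¹
  | .sqrt e, t => Real.sqrt (evalR e t)

/-- The open Bernstein ellipse of parameter `ρ` scaled to the segment `[a, b]`:
`|z − a| + |z − b| < (ρ + ρ⁻¹)(b − a)/2` (foci `a, b`; for `[a, b] = [−1, 1]` the semi-axes sum to `ρ`).
[cite: Trefethen2008, Thm. 4.5] -/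
def ell (ρ a b : ℚ) : Set ℂ :=
  {z : ℂ | ‖z - ((a : ℝ) : ℂ)‖ + ‖z - ((b : ℝ) : ℂ)‖ < ((ρ : ℝ) + (ρ : ℝ)⁻¹) * (((b : ℝ) - a) / 2)}

/-- The segment lies in every ellipse with `ρ > 1`. [cite: Trefethen2008, Thm. 4.5] -/
theorem ofReal_mem_ell {ρ a b : ℚ} (hρ : 1 < ρ) (hab : a < b) {t : ℝ} (ht : t ∈ Set.Icc (a : ℝ) b) :
    (t : ℂ) ∈ ell ρ a b := by
  have hρ1 : (1 : ℝ) < ρ := by exact_mod_cast hρ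
  have hρ0 : (0 : ℝ) < ρ := zero_lt_one.trans hρ1
  have hab' : (a : ℝ) < b := by exact_mod_cast hab
  have h1 : ‖(t : ℂ) - ((a : ℝ) : ℂ)‖ = t - a := by
    rw [← Complex.ofReal_sub, Complex.norm_real, Real.norm_eq_abs, abs_of_nonneg (by linarith [ht.1])]
  have h2 : ‖(t : ℂ) - ((b : ℝ) : ℂ)‖ = b - t := by
    rw [← Complex.ofReal_sub, Complex.norm_real, Real.norm_eq_abs, abs_of_nonpos (by linarith [ht.2])]
    ring
  show ‖(t : ℂ) - ((a : ℝ) : ℂ)‖ + ‖(t : ℂ) - ((b : ℝ) : ℂ)‖ < ((ρ : ℝ) + (ρ : ℝ)⁻¹) * (((b : ℝ) - a) / 2)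
  rw [h1, h2]
  have hc : (2 : ℝ) < (ρ : ℝ) + (ρ : ℝ)⁻¹ := by
    have hinv : (ρ : ℝ) * (ρ : ℝ)⁻¹ = 1 := mul_inv_cancel₀ hρ0.ne'
    nlinarith [sq_nonneg ((ρ : ℝ) - 1), inv_pos.mpr hρ0]
  nlinarith

/-! ### Part B. The certified ellipse majorant: a rational bound arithmetic -/

/-- Ellipse data of a subexpression value `w`: an upper and a lower bound of `|w|`, a range of
`Re w` and a range of `Im w`, valid on the whole ellipse. [cite: Moore1979, Sect. 3.3] -/
structure EB where
  /-- upper bound of `‖w‖` -/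
  ub : ℚ
  /-- lower bound of `‖w‖` -/
  lb : ℚ
  /-- lower bound of `Re w` -/
  relo : ℚ
  /-- upper bound of `Re w` -/
  rehi : ℚ
  /-- lower bound of `Im w` -/
  imlo : ℚ
  /-- upper bound of `Im w` -/
  imhi : ℚ
  deriving Repr

/-- The soundness predicate of ellipse data at one point. [cite: Moore1979, Thm. 3.1] -/
structure EBnd (v : ℂ) (B : EB) : Prop where
  norm_le : ‖v‖ ≤ (B.ub : ℝ)
  le_norm : (B.lb : ℝ) ≤ ‖v‖
  le_re : (B.relo : ℝ) ≤ v.re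
  re_le : v.re ≤ (B.rehi : ℝ)
  le_im : (B.imlo : ℝ) ≤ v.im
  im_le : v.im ≤ (B.imhi : ℝ)

/-- The range of a product `x·y` for `x ∈ [a, b]`, `y ∈ [c, d]`: the hull of the four corner
products. [cite: Moore1979, Sect. 2.2] -/
def imul (a b c d : ℚ) : ℚ × ℚ :=
  (min (min (a * c) (a * d)) (min (b * c) (b * d)), max (max (a * c) (a * d)) (max (b * c) (b * d)))

namespace EB

/-- Ellipse data of a rational constant. [cite: Moore1979, Sect. 3.3] -/
def constB (c : ℚ) : EB := ⟨|c|, |c|, c, c, 0, 0⟩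

/-- Ellipse data of the variable `z` on the ellipse of `[a, b]` with parameter `ρ`: with
`m = (a+b)/2`, `h = (b−a)/2`, `|z − m| ≤ A = h(ρ + ρ⁻¹)/2` and `|Im z| ≤ h(ρ − ρ⁻¹)/2` (the semi-axes),
`|z| ≥ max (m − A, −(m + A), 0)` — Petras's rectangle of side lengths `(ρ + ρ⁻¹)(b−a)/2` and
`(ρ − ρ⁻¹)(b−a)/2` around the ellipse. [cite: Trefethen2008, Thm. 4.5] [cite: Petras2002, Sect. 5.1] -/
def varB (ρ a b : ℚ) : EB :=
  let m := (a + b) / 2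
  let h := (b - a) / 2
  let A := (ρ + ρ⁻¹) / 2 * h
  let B := (ρ - ρ⁻¹) / 2 * h
  ⟨|m| + A, max (max (m - A) (-(m + A))) 0, m - A, m + A, -B, B⟩

/-- Ellipse data of a rational multiple. [cite: Moore1979, Sect. 3.3] -/
def scaleB (q : ℚ) (A : EB) : EB :=
  if 0 ≤ q then ⟨q * A.ub, q * A.lb, q * A.relo, q * A.rehi, q * A.imlo, q * A.imhi⟩
  else ⟨-q * A.ub, -q * A.lb, q * A.rehi, q * A.relo, q * A.imhi, q * A.imlo⟩

/-- Ellipse data of a sum. [cite: Moore1979, Sect. 3.3] -/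
def addB (A B : EB) : EB :=
  ⟨A.ub + B.ub,
    max (max (max (A.lb - B.ub) (B.lb - A.ub)) (max (A.relo + B.relo) (-(A.rehi + B.rehi))))
      (max (A.imlo + B.imlo) (-(A.imhi + B.imhi))),
    A.relo + B.relo, A.rehi + B.rehi, A.imlo + B.imlo, A.imhi + B.imhi⟩

/-- Ellipse data of a negation. [cite: Moore1979, Sect. 3.3] -/
def negB (A : EB) : EB := ⟨A.ub, A.lb, -A.rehi, -A.relo, -A.imhi, -A.imlo⟩

/-- Ellipse data of a difference. [cite: Moore1979, Sect. 3.3] -/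
def subB (A B : EB) : EB := addB A (negB B)

/-- Ellipse data of a product: `|zw| = |z||w|`, `Re zw = Re z Re w − Im z Im w`,
`Im zw = Re z Im w + Im z Re w` in rectangle arithmetic. [cite: Moore1979, Sect. 3.3] -/
def mulB (A B : EB) : EB :=
  let rr := imul A.relo A.rehi B.relo B.rehi
  let ii := imul A.imlo A.imhi B.imlo B.imhi
  let ri := imul A.relo A.rehi B.imlo B.imhi
  let ir := imul A.imlo A.imhi B.relo B.rehi
  let U := A.ub * B.ub
  ⟨U, max A.lb 0 * max B.lb 0, max (rr.1 - ii.2) (-U), min (rr.2 - ii.1) U,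
    max (ri.1 + ir.1) (-U), min (ri.2 + ir.2) U⟩

/-- Ellipse data of a natural power. [cite: Moore1979, Sect. 3.3] -/
def powB (A : EB) : ℕ → EB
  | 0 => constB 1
  | n + 1 => mulB (powB A n) A

/-- Ellipse data of `exp w`: `|e^w| = e^{Re w}`. [cite: Moore1979, Sect. 3.3] -/
def expB (A : EB) : EB :=
  let U := expUb A.rehi
  ⟨U, (expUb (-A.relo))⁻¹, -U, U, -U, U⟩

/-- Ellipse data of `cos w` and `sin w`: `|cos w|, |sin w| ≤ cosh (Im w) ≤ (e^T + 1)/2`,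
`T = max |Im w|`. [cite: Trefethen2008, Thm. 4.5] -/
def trigB (A : EB) : EB :=
  let U := (expUb (max (-A.imlo) A.imhi) + 1) / 2
  ⟨U, 0, -U, U, -U, U⟩

/-- Ellipse data of `w⁻¹` (meaningful when `A.lb > 0`). [cite: Moore1979, Sect. 3.3] -/
def invB (A : EB) : EB := ⟨A.lb⁻¹, A.ub⁻¹, -A.lb⁻¹, A.lb⁻¹, -A.lb⁻¹, A.lb⁻¹⟩

/-- Ellipse data of the principal `√w` (meaningful when `A.relo > 0`): `√u ≤ (1 + u)/2`,
`√u ≥ min (u, 1)`, `Re √w ≥ 0`. [cite: Moore1979, Sect. 3.3] -/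
def sqrtB (A : EB) : EB :=
  let U := (1 + A.ub) / 2
  ⟨U, min (max A.lb A.relo) 1, 0, U, -U, U⟩

end EB

/-- The ellipse data of an expression on the ellipse of `[a, b]` with parameter `ρ`, by structural
recursion. [cite: Moore1979, Sect. 4.4 (4.11)] -/
def ebnd (ρ a b : ℚ) : EExpr → EB
  | .var => EB.varB ρ a b
  | .const c => EB.constB c
  | .scale q e => EB.scaleB q (ebnd ρ a b e)
  | .add e f => EB.addB (ebnd ρ a b e) (ebnd ρ a b f)
  | .sub e f => EB.subB (ebnd ρ a b e) (ebnd ρ a b f)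
  | .neg e => EB.negB (ebnd ρ a b e)
  | .mul e f => EB.mulB (ebnd ρ a b e) (ebnd ρ a b f)
  | .pow e n => EB.powB (ebnd ρ a b e) n
  | .exp e => EB.expB (ebnd ρ a b e)
  | .cos e => EB.trigB (ebnd ρ a b e)
  | .sin e => EB.trigB (ebnd ρ a b e)
  | .inv e => EB.invB (ebnd ρ a b e)
  | .sqrt e => EB.sqrtB (ebnd ρ a b e)

/-- The side conditions making the continuation holomorphic on the ellipse: every reciprocal has a
certified positive lower bound of `|w|`, every radicand a certified positive lower bound of `Re w`
(decided over `ℚ`). [cite: Petras2002, Sect. 3 (2)] -/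
def eok (ρ a b : ℚ) : EExpr → Bool
  | .var => true
  | .const _ => true
  | .scale _ e => eok ρ a b e
  | .add e f => eok ρ a b e && eok ρ a b f
  | .sub e f => eok ρ a b e && eok ρ a b f
  | .neg e => eok ρ a b e
  | .mul e f => eok ρ a b e && eok ρ a b f
  | .pow e _ => eok ρ a b e
  | .exp e => eok ρ a b e
  | .cos e => eok ρ a b e
  | .sin e => eok ρ a b e
  | .inv e => eok ρ a b e && decide (0 < (ebnd ρ a b e).lb)
  | .sqrt e => eok ρ a b e && decide (0 < (ebnd ρ a b e).relo)

/-! #### Soundness of the bound arithmetic -/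

/-- `|cos w| ≤ cosh (Im w)`. [folklore] -/
private theorem norm_cos_le_cosh_im (w : ℂ) : ‖Complex.cos w‖ ≤ Real.cosh w.im := by
  have h1 : ‖Complex.exp (w * Complex.I)‖ = Real.exp (-w.im) := by
    rw [Complex.norm_exp]
    congr 1
    simp [Complex.mul_re]
  have h2 : ‖Complex.exp (-w * Complex.I)‖ = Real.exp w.im := by
    rw [Complex.norm_exp]
    congr 1
    simp [Complex.mul_re]
  have hcos : Complex.cos w = (Complex.exp (w * Complex.I) + Complex.exp (-w * Complex.I)) / 2 := rfl
  rw [hcos, norm_div, Complex.norm_two, Real.cosh_eq]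
  gcongr
  calc ‖Complex.exp (w * Complex.I) + Complex.exp (-w * Complex.I)‖
      ≤ ‖Complex.exp (w * Complex.I)‖ + ‖Complex.exp (-w * Complex.I)‖ := norm_add_le _ _
    _ = Real.exp w.im + Real.exp (-w.im) := by rw [h1, h2, add_comm]

/-- `|sin w| ≤ cosh (Im w)`. [folklore] -/
private theorem norm_sin_le_cosh_im (w : ℂ) : ‖Complex.sin w‖ ≤ Real.cosh w.im := by
  have h1 : ‖Complex.exp (w * Complex.I)‖ = Real.exp (-w.im) := by
    rw [Complex.norm_exp]
    congr 1
    simp [Complex.mul_re]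
  have h2 : ‖Complex.exp (-w * Complex.I)‖ = Real.exp w.im := by
    rw [Complex.norm_exp]
    congr 1
    simp [Complex.mul_re]
  have hsin : Complex.sin w =
      (Complex.exp (-w * Complex.I) - Complex.exp (w * Complex.I)) * Complex.I / 2 := rfl
  rw [hsin, norm_div, norm_mul, Complex.norm_I, mul_one, Complex.norm_two, Real.cosh_eq]
  gcongr
  calc ‖Complex.exp (-w * Complex.I) - Complex.exp (w * Complex.I)‖
      ≤ ‖Complex.exp (-w * Complex.I)‖ + ‖Complex.exp (w * Complex.I)‖ := norm_sub_le _ _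
    _ = Real.exp w.im + Real.exp (-w.im) := by rw [h1, h2]

/-- `e^x ≤ expUb q` for `x ≤ q`. [folklore] -/
private theorem exp_le_expUb {x : ℝ} {q : ℚ} (h : x ≤ q) : Real.exp x ≤ ((expUb q : ℚ) : ℝ) := by
  unfold expUb
  push_cast
  have hq : (q : ℝ) ≤ ((⌈q⌉₊ : ℕ) : ℝ) := by exact_mod_cast Nat.le_ceil q
  have he : Real.exp 1 ≤ (68 / 25 : ℝ) := by
    have := Real.exp_one_lt_d9
    norm_num at this ⊢
    linarith
  calc Real.exp x ≤ Real.exp ((⌈q⌉₊ : ℕ) : ℝ) := Real.exp_le_exp.mpr (h.trans hq)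
    _ = Real.exp 1 ^ ⌈q⌉₊ := by rw [← Real.exp_nat_mul, mul_one]
    _ ≤ (68 / 25 : ℝ) ^ ⌈q⌉₊ := pow_le_pow_left₀ (Real.exp_pos 1).le he _

/-- Ellipse data from a norm enclosure alone. [folklore] -/
private theorem ebnd_of_norm {v : ℂ} {U L : ℚ} (hU : ‖v‖ ≤ (U : ℝ)) (hL : (L : ℝ) ≤ ‖v‖) :
    EBnd v ⟨U, L, -U, U, -U, U⟩ := by
  have hre := Complex.abs_re_le_norm v
  have him := Complex.abs_im_le_norm v
  rw [abs_le] at hre him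
  refine ⟨hU, hL, ?_, ?_, ?_, ?_⟩
  · push_cast; linarith [hre.1]
  · linarith [hre.2]
  · push_cast; linarith [him.1]
  · linarith [him.2]

/-- The corner-product enclosure of a real product. [cite: Moore1979, Sect. 2.2] -/
private theorem mul_mem_corners {a b c d x y : ℝ} (hxa : a ≤ x) (hxb : x ≤ b) (hyc : c ≤ y)
    (hyd : y ≤ d) :
    min (min (a * c) (a * d)) (min (b * c) (b * d)) ≤ x * y ∧
      x * y ≤ max (max (a * c) (a * d)) (max (b * c) (b * d)) := by
  have hay : min (a * c) (a * d) ≤ a * y ∧ a * y ≤ max (a * c) (a * d) := by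
    rcases le_total 0 a with ha | ha
    · exact ⟨(min_le_left _ _).trans (by nlinarith), (le_max_right _ _).trans' (by nlinarith)⟩
    · exact ⟨(min_le_right _ _).trans (by nlinarith), (le_max_left _ _).trans' (by nlinarith)⟩
  have hby : min (b * c) (b * d) ≤ b * y ∧ b * y ≤ max (b * c) (b * d) := by
    rcases le_total 0 b with hb | hb
    · exact ⟨(min_le_left _ _).trans (by nlinarith), (le_max_right _ _).trans' (by nlinarith)⟩
    · exact ⟨(min_le_right _ _).trans (by nlinarith), (le_max_left _ _).trans' (by nlinarith)⟩
  rcases le_total 0 y with hy | hy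
  · exact ⟨(min_le_left _ _).trans (hay.1.trans (by nlinarith)),
      (le_max_right _ _).trans' (hby.2.trans' (by nlinarith))⟩
  · exact ⟨(min_le_right _ _).trans (hby.1.trans (by nlinarith)),
      (le_max_left _ _).trans' (hay.2.trans' (by nlinarith))⟩

/-- The corner-product enclosure, rational endpoints. [cite: Moore1979, Sect. 2.2] -/
private theorem mem_imul {a b c d : ℚ} {x y : ℝ} (hxa : (a : ℝ) ≤ x) (hxb : x ≤ (b : ℝ))
    (hyc : (c : ℝ) ≤ y) (hyd : y ≤ (d : ℝ)) :
    (((imul a b c d).1 : ℚ) : ℝ) ≤ x * y ∧ x * y ≤ (((imul a b c d).2 : ℚ) : ℝ) := by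
  have h := mul_mem_corners hxa hxb hyc hyd
  simp only [imul]
  push_cast
  exact h

/-- Soundness of `constB`. [cite: Moore1979, Thm. 3.1] -/
theorem EBnd.const (c : ℚ) : EBnd (c : ℂ) (EB.constB c) where
  norm_le := by rw [Complex.norm_ratCast]; push_cast [EB.constB]; exact le_rfl
  le_norm := by rw [Complex.norm_ratCast]; push_cast [EB.constB]; exact le_rfl
  le_re := by simp [EB.constB]
  re_le := by simp [EB.constB]
  le_im := by simp [EB.constB]
  im_le := by simp [EB.constB]

/-- Soundness of `varB`: the rectangle and modulus bounds of a point of the ellipse.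
[cite: Trefethen2008, Thm. 4.5] -/
theorem EBnd.var {ρ a b : ℚ} (hρ : 1 < ρ) (hab : a < b) {z : ℂ} (hz : z ∈ ell ρ a b) :
    EBnd z (EB.varB ρ a b) := by
  have hρ1 : (1 : ℝ) < ρ := by exact_mod_cast hρ
  have hρ0 : (0 : ℝ) < ρ := zero_lt_one.trans hρ1
  have hinv : (ρ : ℝ) * (ρ : ℝ)⁻¹ = 1 := mul_inv_cancel₀ hρ0.ne'
  have hinv1 : (ρ : ℝ)⁻¹ < 1 := inv_lt_one_of_one_lt₀ hρ1
  have hab' : (a : ℝ) < b := by exact_mod_cast hab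
  have hz' : ‖z - ((a : ℝ) : ℂ)‖ + ‖z - ((b : ℝ) : ℂ)‖ < ((ρ : ℝ) + (ρ : ℝ)⁻¹) * (((b : ℝ) - a) / 2) :=
    hz
  set m : ℝ := ((a : ℝ) + b) / 2 with hm
  set h : ℝ := ((b : ℝ) - a) / 2 with hh
  set A : ℝ := ((ρ : ℝ) + (ρ : ℝ)⁻¹) / 2 * h with hA
  set B : ℝ := ((ρ : ℝ) - (ρ : ℝ)⁻¹) / 2 * h with hB
  have hB0 : 0 ≤ B := by rw [hB]; exact mul_nonneg (by linarith) (by linarith)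
  -- `|z - m| ≤ A`
  have hzm : ‖z - (m : ℂ)‖ ≤ A := by
    have e1 : (2 : ℂ) * (z - (m : ℂ)) = (z - ((a : ℝ) : ℂ)) + (z - ((b : ℝ) : ℂ)) := by
      rw [hm]; push_cast; ring
    have h2 : 2 * ‖z - (m : ℂ)‖ ≤ ‖z - ((a : ℝ) : ℂ)‖ + ‖z - ((b : ℝ) : ℂ)‖ := by
      have := norm_add_le (z - ((a : ℝ) : ℂ)) (z - ((b : ℝ) : ℂ))
      rw [← e1, norm_mul, Complex.norm_two] at this
      exact this
    rw [hA]
    linarith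
  have hre := Complex.abs_re_le_norm (z - (m : ℂ))
  rw [abs_le, Complex.sub_re, Complex.ofReal_re] at hre
  -- `|Im z| ≤ B`
  have him : |z.im| < B := by
    set w : ℂ := (z - ((a : ℝ) : ℂ)) - (starRingEnd ℂ) (z - ((b : ℝ) : ℂ)) with hw
    have hwn : ‖w‖ < ((ρ : ℝ) + (ρ : ℝ)⁻¹) * h := by
      calc ‖w‖ ≤ ‖z - ((a : ℝ) : ℂ)‖ + ‖(starRingEnd ℂ) (z - ((b : ℝ) : ℂ))‖ := norm_sub_le _ _
        _ = ‖z - ((a : ℝ) : ℂ)‖ + ‖z - ((b : ℝ) : ℂ)‖ := by rw [Complex.norm_conj]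
        _ < _ := hz'
    have hwre : w.re = 2 * h := by
      rw [hw, hh]; simp [Complex.sub_re, Complex.conj_re]; ring
    have hwim : w.im = 2 * z.im := by
      rw [hw]; simp [Complex.sub_im, Complex.conj_im]; ring
    have hc0 : 0 ≤ ((ρ : ℝ) + (ρ : ℝ)⁻¹) * h := by positivity
    have hsq : ‖w‖ ^ 2 < (((ρ : ℝ) + (ρ : ℝ)⁻¹) * h) ^ 2 :=
      pow_lt_pow_left₀ hwn (norm_nonneg _) two_ne_zero
    rw [Complex.sq_norm, Complex.normSq_apply, hwre, hwim] at hsq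
    have hkey : z.im ^ 2 < B ^ 2 := by
      rw [hB]
      nlinarith [hsq, hinv]
    exact abs_lt_of_sq_lt_sq hkey hB0
  rw [abs_lt] at him
  have hnorm : ‖z‖ ≤ |m| + A := by
    calc ‖z‖ = ‖(z - (m : ℂ)) + (m : ℂ)‖ := by rw [sub_add_cancel]
      _ ≤ ‖z - (m : ℂ)‖ + ‖(m : ℂ)‖ := norm_add_le _ _
      _ ≤ A + |m| := by rw [Complex.norm_real, Real.norm_eq_abs]; linarith
      _ = |m| + A := add_comm _ _
  have hzre := Complex.abs_re_le_norm z
  rw [abs_le] at hzre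
  refine ⟨?_, ?_, ?_, ?_, ?_, ?_⟩ <;> simp only [EB.varB] <;> push_cast
  · rw [← hm, ← hh, ← hA]; exact hnorm
  · rw [← hm, ← hh, ← hA]
    refine max_le (max_le ?_ ?_) (norm_nonneg z) <;> linarith [hre.1, hre.2, hzre.1, hzre.2]
  · rw [← hm, ← hh, ← hA]; linarith [hre.2]
  · rw [← hm, ← hh, ← hA]; linarith [hre.1]
  · rw [← hh, ← hB]; linarith [him.1]
  · rw [← hh, ← hB]; linarith [him.2]

/-- Soundness of `scaleB`. [cite: Moore1979, Thm. 3.1] -/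
theorem EBnd.scale (q : ℚ) {z : ℂ} {A : EB} (hz : EBnd z A) : EBnd ((q : ℂ) * z) (EB.scaleB q A) := by
  have hn : ‖(q : ℂ) * z‖ = |(q : ℝ)| * ‖z‖ := by rw [norm_mul, Complex.norm_ratCast]
  have hre : ((q : ℂ) * z).re = (q : ℝ) * z.re := by simp [Complex.mul_re]
  have him : ((q : ℂ) * z).im = (q : ℝ) * z.im := by simp [Complex.mul_im]
  obtain ⟨h1, h2, h3, h4, h5, h6⟩ := hz
  have hz0 : 0 ≤ ‖z‖ := norm_nonneg z
  unfold EB.scaleB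
  split_ifs with hq
  · have hq' : (0 : ℝ) ≤ q := by exact_mod_cast hq
    refine ⟨?_, ?_, ?_, ?_, ?_, ?_⟩ <;> simp only [hn, hre, him] <;> push_cast
    · rw [abs_of_nonneg hq']; exact mul_le_mul_of_nonneg_left h1 hq'
    · rw [abs_of_nonneg hq']; exact mul_le_mul_of_nonneg_left h2 hq'
    · exact mul_le_mul_of_nonneg_left h3 hq'
    · exact mul_le_mul_of_nonneg_left h4 hq'
    · exact mul_le_mul_of_nonneg_left h5 hq'
    · exact mul_le_mul_of_nonneg_left h6 hq'
  · have hq' : (q : ℝ) ≤ 0 := by exact_mod_cast (not_le.mp hq).le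
    refine ⟨?_, ?_, ?_, ?_, ?_, ?_⟩ <;> simp only [hn, hre, him] <;> push_cast
    · rw [abs_of_nonpos hq']; exact mul_le_mul_of_nonneg_left h1 (by linarith)
    · rw [abs_of_nonpos hq']; exact mul_le_mul_of_nonneg_left h2 (by linarith)
    · exact mul_le_mul_of_nonpos_left h4 hq'
    · exact mul_le_mul_of_nonpos_left h3 hq'
    · exact mul_le_mul_of_nonpos_left h6 hq'
    · exact mul_le_mul_of_nonpos_left h5 hq'

/-- Soundness of `addB`. [cite: Moore1979, Thm. 3.1] -/
theorem EBnd.add {z w : ℂ} {A B : EB} (hz : EBnd z A) (hw : EBnd w B) :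
    EBnd (z + w) (A.addB B) where
  norm_le := by
    simp only [EB.addB]
    push_cast
    exact (norm_add_le z w).trans (add_le_add hz.norm_le hw.norm_le)
  le_norm := by
    simp only [EB.addB]
    push_cast
    have h1 : ‖z‖ ≤ ‖z + w‖ + ‖w‖ := norm_le_add_norm_add z w
    have h2 : ‖w‖ ≤ ‖z + w‖ + ‖z‖ := norm_le_add_norm_add' z w
    have h4 := Complex.abs_re_le_norm (z + w)
    have h5 := Complex.abs_im_le_norm (z + w)
    rw [abs_le, Complex.add_re] at h4
    rw [abs_le, Complex.add_im] at h5
    have := hz.norm_le; have := hw.norm_le; have := hz.le_norm; have := hw.le_norm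
    have := hz.le_re; have := hw.le_re; have := hz.re_le; have := hw.re_le
    have := hz.le_im; have := hw.le_im; have := hz.im_le; have := hw.im_le
    refine max_le (max_le (max_le ?_ ?_) (max_le ?_ ?_)) (max_le ?_ ?_) <;>
      linarith [h4.1, h4.2, h5.1, h5.2]
  le_re := by
    simp only [EB.addB, Complex.add_re]
    push_cast
    linarith [hz.le_re, hw.le_re]
  re_le := by
    simp only [EB.addB, Complex.add_re]
    push_cast
    linarith [hz.re_le, hw.re_le]
  le_im := by
    simp only [EB.addB, Complex.add_im]
    push_cast
    linarith [hz.le_im, hw.le_im]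
  im_le := by
    simp only [EB.addB, Complex.add_im]
    push_cast
    linarith [hz.im_le, hw.im_le]

/-- Soundness of `negB`. [cite: Moore1979, Thm. 3.1] -/
theorem EBnd.neg {z : ℂ} {A : EB} (hz : EBnd z A) : EBnd (-z) A.negB where
  norm_le := by simp only [EB.negB, norm_neg]; exact hz.norm_le
  le_norm := by simp only [EB.negB, norm_neg]; exact hz.le_norm
  le_re := by simp only [EB.negB, Complex.neg_re]; push_cast; linarith [hz.re_le]
  re_le := by simp only [EB.negB, Complex.neg_re]; push_cast; linarith [hz.le_re]
  le_im := by simp only [EB.negB, Complex.neg_im]; push_cast; linarith [hz.im_le]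
  im_le := by simp only [EB.negB, Complex.neg_im]; push_cast; linarith [hz.le_im]

/-- Soundness of `subB`. [cite: Moore1979, Thm. 3.1] -/
theorem EBnd.sub {z w : ℂ} {A B : EB} (hz : EBnd z A) (hw : EBnd w B) :
    EBnd (z - w) (A.subB B) := by
  rw [sub_eq_add_neg]
  exact hz.add hw.neg

/-- Soundness of `mulB`. [cite: Moore1979, Thm. 3.1] -/
theorem EBnd.mul {z w : ℂ} {A B : EB} (hz : EBnd z A) (hw : EBnd w B) :
    EBnd (z * w) (A.mulB B) := by
  have hU : ‖z * w‖ ≤ ((A.ub * B.ub : ℚ) : ℝ) := by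
    rw [norm_mul]
    push_cast
    exact mul_le_mul hz.norm_le hw.norm_le (norm_nonneg w)
      ((norm_nonneg z).trans hz.norm_le)
  have hL : ((max A.lb 0 * max B.lb 0 : ℚ) : ℝ) ≤ ‖z * w‖ := by
    rw [norm_mul]
    push_cast
    exact mul_le_mul (max_le hz.le_norm (norm_nonneg z)) (max_le hw.le_norm (norm_nonneg w))
      (le_max_right _ _) (norm_nonneg z)
  have h0 := ebnd_of_norm hU hL
  have hrr := mem_imul hz.le_re hz.re_le hw.le_re hw.re_le
  have hii := mem_imul hz.le_im hz.im_le hw.le_im hw.im_le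
  have hri := mem_imul hz.le_re hz.re_le hw.le_im hw.im_le
  have hir := mem_imul hz.le_im hz.im_le hw.le_re hw.re_le
  have hre : (z * w).re = z.re * w.re - z.im * w.im := Complex.mul_re z w
  have him : (z * w).im = z.re * w.im + z.im * w.re := Complex.mul_im z w
  refine ⟨h0.norm_le, h0.le_norm, ?_, ?_, ?_, ?_⟩ <;> simp only [EB.mulB] <;> push_cast
  · refine max_le ?_ (by simpa using h0.le_re)
    rw [hre]; linarith [hrr.1, hii.2]
  · refine le_min ?_ (by simpa using h0.re_le)
    rw [hre]; linarith [hrr.2, hii.1]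
  · refine max_le ?_ (by simpa using h0.le_im)
    rw [him]; linarith [hri.1, hir.1]
  · refine le_min ?_ (by simpa using h0.im_le)
    rw [him]; linarith [hri.2, hir.2]

/-- Soundness of `powB`. [cite: Moore1979, Thm. 3.1] -/
theorem EBnd.pow {z : ℂ} {A : EB} (hz : EBnd z A) : ∀ n : ℕ, EBnd (z ^ n) (A.powB n)
  | 0 => by simpa [EB.powB] using EBnd.const 1
  | n + 1 => by
    rw [pow_succ]
    exact (EBnd.pow hz n).mul hz

/-- Soundness of `expB`. [cite: Moore1979, Thm. 3.1] -/
theorem EBnd.exp {z : ℂ} {A : EB} (hz : EBnd z A) : EBnd (Complex.exp z) A.expB := by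
  have hU : ‖Complex.exp z‖ ≤ ((expUb A.rehi : ℚ) : ℝ) := by
    rw [Complex.norm_exp]
    exact exp_le_expUb hz.re_le
  have hL : (((expUb (-A.relo))⁻¹ : ℚ) : ℝ) ≤ ‖Complex.exp z‖ := by
    rw [Complex.norm_exp, Rat.cast_inv]
    have h1 : Real.exp (-z.re) ≤ ((expUb (-A.relo) : ℚ) : ℝ) :=
      exp_le_expUb (by push_cast; linarith [hz.le_re])
    have h2 := inv_anti₀ (Real.exp_pos _) h1
    rwa [Real.exp_neg, inv_inv] at h2
  exact ebnd_of_norm hU hL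

/-- `cosh (Im z) ≤ (expUb T + 1)/2` with `T = max (−imlo) imhi`. [folklore] -/
private theorem cosh_im_le_trig {z : ℂ} {A : EB} (hz : EBnd z A) :
    Real.cosh z.im ≤ (((expUb (max (-A.imlo) A.imhi) + 1) / 2 : ℚ) : ℝ) := by
  set T : ℚ := max (-A.imlo) A.imhi with hT
  have hT1 : |z.im| ≤ (T : ℝ) := by
    rw [abs_le, hT]
    push_cast
    constructor
    · have := le_max_left (-(A.imlo : ℝ)) (A.imhi : ℝ)
      linarith [hz.le_im]
    · exact hz.im_le.trans (le_max_right _ _)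
  have hT0 : (0 : ℝ) ≤ T := (abs_nonneg _).trans hT1
  have h1 : Real.cosh z.im ≤ Real.cosh (T : ℝ) :=
    Real.cosh_le_cosh.mpr (by rw [abs_of_nonneg hT0]; exact hT1)
  have h2 : Real.exp (T : ℝ) ≤ ((expUb T : ℚ) : ℝ) := exp_le_expUb le_rfl
  have h3 : Real.exp (-(T : ℝ)) ≤ 1 := by
    rw [Real.exp_le_one_iff]
    linarith
  have h4 : Real.cosh (T : ℝ) = (Real.exp (T : ℝ) + Real.exp (-(T : ℝ))) / 2 := Real.cosh_eq _
  push_cast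
  linarith

/-- Soundness of `trigB` for `cos`. [cite: Moore1979, Thm. 3.1] -/
theorem EBnd.cos {z : ℂ} {A : EB} (hz : EBnd z A) : EBnd (Complex.cos z) A.trigB :=
  ebnd_of_norm ((norm_cos_le_cosh_im z).trans (cosh_im_le_trig hz))
    (by push_cast; exact norm_nonneg _)

/-- Soundness of `trigB` for `sin`. [cite: Moore1979, Thm. 3.1] -/
theorem EBnd.sin {z : ℂ} {A : EB} (hz : EBnd z A) : EBnd (Complex.sin z) A.trigB :=
  ebnd_of_norm ((norm_sin_le_cosh_im z).trans (cosh_im_le_trig hz))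
    (by push_cast; exact norm_nonneg _)

/-- Soundness of `invB` under `0 < lb`. [cite: Moore1979, Thm. 3.1] -/
theorem EBnd.inv {z : ℂ} {A : EB} (hz : EBnd z A) (hlb : 0 < A.lb) : EBnd z⁻¹ A.invB := by
  have hlb' : (0 : ℝ) < A.lb := by exact_mod_cast hlb
  have hzpos : 0 < ‖z‖ := hlb'.trans_le hz.le_norm
  have hU : ‖z⁻¹‖ ≤ ((A.lb⁻¹ : ℚ) : ℝ) := by
    rw [norm_inv, Rat.cast_inv]
    exact inv_anti₀ hlb' hz.le_norm
  have hL : ((A.ub⁻¹ : ℚ) : ℝ) ≤ ‖z⁻¹‖ := by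
    rw [norm_inv, Rat.cast_inv]
    exact inv_anti₀ hzpos hz.norm_le
  exact ebnd_of_norm hU hL

/-- A point with certified positive `lb` is nonzero. [folklore] -/
private theorem ne_zero_of_lb {z : ℂ} {A : EB} (hz : EBnd z A) (hlb : 0 < A.lb) : z ≠ 0 := by
  have hlb' : (0 : ℝ) < A.lb := by exact_mod_cast hlb
  exact norm_pos_iff.mp (hlb'.trans_le hz.le_norm)

/-- A point with certified positive `relo` lies in the slit plane. [folklore] -/
private theorem mem_slitPlane_of_relo {z : ℂ} {A : EB} (hz : EBnd z A) (h : 0 < A.relo) :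
    z ∈ Complex.slitPlane := by
  have h' : (0 : ℝ) < A.relo := by exact_mod_cast h
  exact Complex.mem_slitPlane_iff.mpr (Or.inl (h'.trans_le hz.le_re))

/-- Soundness of `sqrtB` (the bounds hold for the principal branch unconditionally; `0 < relo` is
what makes the branch holomorphic). [cite: Moore1979, Thm. 3.1] -/
theorem EBnd.sqrt {z : ℂ} {A : EB} (hz : EBnd z A) :
    EBnd (z ^ (((1 : ℝ) / 2 : ℝ) : ℂ)) A.sqrtB := by
  have hnorm : ‖z ^ (((1 : ℝ) / 2 : ℝ) : ℂ)‖ = Real.sqrt ‖z‖ := by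
    rw [Complex.norm_cpow_real, Real.sqrt_eq_rpow]
  have hU0 : (0 : ℝ) ≤ A.ub := (norm_nonneg z).trans hz.norm_le
  have hU : ‖z ^ (((1 : ℝ) / 2 : ℝ) : ℂ)‖ ≤ (((1 + A.ub) / 2 : ℚ) : ℝ) := by
    rw [hnorm]
    push_cast
    calc Real.sqrt ‖z‖ ≤ Real.sqrt (A.ub : ℝ) := Real.sqrt_le_sqrt hz.norm_le
      _ ≤ (1 + (A.ub : ℝ)) / 2 := by
        rw [Real.sqrt_le_left (by linarith)]
        nlinarith [sq_nonneg ((A.ub : ℝ) - 1)]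
  have hL : ((min (max A.lb A.relo) 1 : ℚ) : ℝ) ≤ ‖z ^ (((1 : ℝ) / 2 : ℝ) : ℂ)‖ := by
    rw [hnorm]
    push_cast
    have hmax : max (A.lb : ℝ) (A.relo : ℝ) ≤ ‖z‖ :=
      max_le hz.le_norm (hz.le_re.trans (Complex.re_le_norm z))
    by_cases h1 : 1 ≤ ‖z‖
    · calc min (max (A.lb : ℝ) (A.relo : ℝ)) 1 ≤ 1 := min_le_right _ _
        _ ≤ Real.sqrt ‖z‖ := by rw [Real.le_sqrt (by norm_num) (by linarith)]; linarith
    · have h1 := not_le.mp h1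
      calc min (max (A.lb : ℝ) (A.relo : ℝ)) 1 ≤ ‖z‖ := (min_le_left _ _).trans hmax
        _ ≤ Real.sqrt ‖z‖ := by
          rw [Real.le_sqrt (norm_nonneg z) (norm_nonneg z)]
          nlinarith [norm_nonneg z]
  have h0 := ebnd_of_norm hU hL
  refine ⟨by simpa [EB.sqrtB] using hU, by simpa [EB.sqrtB] using hL, ?_,
    by simpa [EB.sqrtB] using h0.re_le, by simpa [EB.sqrtB] using h0.le_im,
    by simpa [EB.sqrtB] using h0.im_le⟩
  simp only [EB.sqrtB, Rat.cast_zero]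
  rw [Complex.cpow_ofReal_re]
  refine mul_nonneg (Real.rpow_nonneg (norm_nonneg z) _) (Real.cos_nonneg_of_mem_Icc ⟨?_, ?_⟩)
  · have := Complex.neg_pi_lt_arg z
    linarith
  · have := Complex.arg_le_pi z
    linarith

/-! #### The soundness theorem of the ellipse calculus -/

/-- **Soundness of the majorant calculus.**  If the side conditions hold, then at every point of
the ellipse the value of every subexpression satisfies its ellipse data AND the continuation is
complex-differentiable there (one induction). [cite: Moore1979, Thm. 3.1]
[cite: Petras2002, Sect. 3 (2)] -/
theorem ebnd_evalC {ρ a b : ℚ} (hρ : 1 < ρ) (hab : a < b) :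
    ∀ (e : EExpr), eok ρ a b e = true →
      ∀ z : ℂ, z ∈ ell ρ a b → EBnd (evalC e z) (ebnd ρ a b e) ∧ DifferentiableAt ℂ (evalC e) z := by
  intro e
  induction e with
  | var =>
    intro _ z hz
    simp only [evalC, ebnd]
    exact ⟨EBnd.var hρ hab hz, differentiableAt_id⟩
  | const c =>
    intro _ z hz
    simp only [evalC, ebnd]
    exact ⟨EBnd.const c, differentiableAt_const _⟩
  | scale q e ih =>
    intro hok z hz
    simp only [eok] at hok
    have h1 := ih hok z hz
    simp only [evalC, ebnd]
    exact ⟨h1.1.scale q, h1.2.const_mul _⟩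
  | add e f ihe ihf =>
    intro hok z hz
    simp only [eok, Bool.and_eq_true] at hok
    have h1 := ihe hok.1 z hz
    have h2 := ihf hok.2 z hz
    simp only [evalC, ebnd]
    exact ⟨h1.1.add h2.1, h1.2.add h2.2⟩
  | sub e f ihe ihf =>
    intro hok z hz
    simp only [eok, Bool.and_eq_true] at hok
    have h1 := ihe hok.1 z hz
    have h2 := ihf hok.2 z hz
    simp only [evalC, ebnd]
    exact ⟨h1.1.sub h2.1, h1.2.sub h2.2⟩
  | neg e ih =>
    intro hok z hz
    simp only [eok] at hok
    have h1 := ih hok z hz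
    simp only [evalC, ebnd]
    exact ⟨h1.1.neg, h1.2.neg⟩
  | mul e f ihe ihf =>
    intro hok z hz
    simp only [eok, Bool.and_eq_true] at hok
    have h1 := ihe hok.1 z hz
    have h2 := ihf hok.2 z hz
    simp only [evalC, ebnd]
    exact ⟨h1.1.mul h2.1, h1.2.mul h2.2⟩
  | pow e n ih =>
    intro hok z hz
    simp only [eok] at hok
    have h1 := ih hok z hz
    simp only [evalC, ebnd]
    exact ⟨h1.1.pow n, h1.2.pow n⟩
  | exp e ih =>
    intro hok z hz
    simp only [eok] at hok
    have h1 := ih hok z hz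
    simp only [evalC, ebnd]
    exact ⟨h1.1.exp, h1.2.cexp⟩
  | cos e ih =>
    intro hok z hz
    simp only [eok] at hok
    have h1 := ih hok z hz
    simp only [evalC, ebnd]
    exact ⟨h1.1.cos, h1.2.ccos⟩
  | sin e ih =>
    intro hok z hz
    simp only [eok] at hok
    have h1 := ih hok z hz
    simp only [evalC, ebnd]
    exact ⟨h1.1.sin, h1.2.csin⟩
  | inv e ih =>
    intro hok z hz
    simp only [eok, Bool.and_eq_true, decide_eq_true_eq] at hok
    have h1 := ih hok.1 z hz
    simp only [evalC, ebnd]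
    exact ⟨h1.1.inv hok.2, h1.2.inv (ne_zero_of_lb h1.1 hok.2)⟩
  | sqrt e ih =>
    intro hok z hz
    simp only [eok, Bool.and_eq_true, decide_eq_true_eq] at hok
    have h1 := ih hok.1 z hz
    simp only [evalC, ebnd]
    exact ⟨h1.1.sqrt, h1.2.cpow_const (mem_slitPlane_of_relo h1.1 hok.2)⟩

/-- Analyticity of the continuation on the ellipse. [cite: Trefethen2008, Thm. 4.5] -/
theorem differentiableOn_evalC {ρ a b : ℚ} (hρ : 1 < ρ) (hab : a < b) {e : EExpr}
    (hok : eok ρ a b e = true) : DifferentiableOn ℂ (evalC e) (ell ρ a b) :=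
  fun z hz => ((ebnd_evalC hρ hab e hok z hz).2).differentiableWithinAt

/-- The ellipse bound `|f(z)| ≤ ub`. [cite: Trefethen2008, Thm. 4.5] -/
theorem norm_evalC_le {ρ a b : ℚ} (hρ : 1 < ρ) (hab : a < b) {e : EExpr}
    (hok : eok ρ a b e = true) {z : ℂ} (hz : z ∈ ell ρ a b) :
    ‖evalC e z‖ ≤ ((ebnd ρ a b e).ub : ℝ) :=
  (ebnd_evalC hρ hab e hok z hz).1.norm_le

/-- On the segment the complex semantics is the real integrand. [cite: Trefethen2008, Thm. 4.5] -/
theorem evalC_ofReal {ρ a b : ℚ} (hρ : 1 < ρ) (hab : a < b) :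
    ∀ (e : EExpr), eok ρ a b e = true →
      ∀ t : ℝ, t ∈ Set.Icc (a : ℝ) b → evalC e (t : ℂ) = ((evalR e t : ℝ) : ℂ) := by
  intro e
  induction e with
  | var => intro _ t _; simp only [evalC, evalR]
  | const c => intro _ t _; simp only [evalC, evalR]; push_cast; rfl
  | scale q e ih =>
    intro hok t ht
    simp only [eok] at hok
    simp only [evalC, evalR, ih hok t ht]
    push_cast
    rfl
  | add e f ihe ihf =>
    intro hok t ht
    simp only [eok, Bool.and_eq_true] at hok
    simp only [evalC, evalR, ihe hok.1 t ht, ihf hok.2 t ht]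
    push_cast
    rfl
  | sub e f ihe ihf =>
    intro hok t ht
    simp only [eok, Bool.and_eq_true] at hok
    simp only [evalC, evalR, ihe hok.1 t ht, ihf hok.2 t ht]
    push_cast
    rfl
  | neg e ih =>
    intro hok t ht
    simp only [eok] at hok
    simp only [evalC, evalR, ih hok t ht]
    push_cast
    rfl
  | mul e f ihe ihf =>
    intro hok t ht
    simp only [eok, Bool.and_eq_true] at hok
    simp only [evalC, evalR, ihe hok.1 t ht, ihf hok.2 t ht]
    push_cast
    rfl
  | pow e n ih =>
    intro hok t ht
    simp only [eok] at hok
    simp only [evalC, evalR, ih hok t ht]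
    push_cast
    rfl
  | exp e ih =>
    intro hok t ht
    simp only [eok] at hok
    simp only [evalC, evalR, ih hok t ht]
    exact (Complex.ofReal_exp _).symm
  | cos e ih =>
    intro hok t ht
    simp only [eok] at hok
    simp only [evalC, evalR, ih hok t ht]
    exact (Complex.ofReal_cos _).symm
  | sin e ih =>
    intro hok t ht
    simp only [eok] at hok
    simp only [evalC, evalR, ih hok t ht]
    exact (Complex.ofReal_sin _).symm
  | inv e ih =>
    intro hok t ht
    simp only [eok, Bool.and_eq_true, decide_eq_true_eq] at hok
    simp only [evalC, evalR, ih hok.1 t ht]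
    exact (Complex.ofReal_inv _).symm
  | sqrt e ih =>
    intro hok t ht
    simp only [eok, Bool.and_eq_true, decide_eq_true_eq] at hok
    have hpos : 0 ≤ evalR e t := by
      have h1 := (ebnd_evalC hρ hab e hok.1 (t : ℂ) (ofReal_mem_ell hρ hab ht)).1.le_re
      rw [ih hok.1 t ht, Complex.ofReal_re] at h1
      have h2 : (0 : ℝ) < (ebnd ρ a b e).relo := by exact_mod_cast hok.2
      linarith
    simp only [evalC, evalR, ih hok.1 t ht]
    rw [Real.sqrt_eq_rpow, Complex.ofReal_cpow hpos]

/-! ### Part C. The certified error bound of the `(n+1)`-point Gauss–Legendre rule on `[a, b]` -/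

/-- **Gauss–Legendre quadrature of an analytic integrand, certified form.**  If `eok ρ a b e`
(`ρ > 1`, `a < b` rational), the `(n+1)`-point Gauss–Legendre rule of the real integrand `f = evalR e`
transported to `[a, b]` satisfies
`|∫ₐᵇ f − Σ_{x ∈ nodes} (b−a)/2·λ_x·f((b−a)/2·x + (a+b)/2)| ≤ (b−a)/2 · 8·ub/((ρ − 1) ρ^{2n+1})`
with the certified ellipse bound `ub = (ebnd ρ a b e).ub` — Trefethen's (4.14) with `M = ub`, the error
term of one Petras–Johansson step. [cite: Trefethen2008, Thm. 4.5] [cite: Petras2002, Sect. 3 (2)]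
[cite: Johansson2018, Sect. 2] -/
theorem abs_integral_sub_gl_le {ρ a b : ℚ} (hρ : 1 < ρ) (hab : a < b) {e : EExpr}
    (hok : eok ρ a b e = true) (n : ℕ) :
    |(∫ t in (a : ℝ)..b, evalR e t) - ∑ x ∈ gaussLegendreNodes (n + 1),
        ((b : ℝ) - a) / 2 * gaussLegendreWeight (n + 1) x *
          evalR e (((b : ℝ) - a) / 2 * x + ((a : ℝ) + b) / 2)| ≤
      ((b : ℝ) - a) / 2 *
        (8 * ((ebnd ρ a b e).ub : ℝ) / (((ρ : ℝ) - 1) * (ρ : ℝ) ^ (2 * (n + 1) - 1))) := by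
  have hρ1 : (1 : ℝ) < ρ := by exact_mod_cast hρ
  have hab' : (a : ℝ) < b := by exact_mod_cast hab
  have key := Literature.Analysis.Quadrature.norm_integral_sub_gaussLegendre_le_interval
    (f := evalC e) (M := ((ebnd ρ a b e).ub : ℝ)) hρ1 hab' (differentiableOn_evalC hρ hab hok)
    (fun z hz => norm_evalC_le hρ hab hok hz) (n := n + 1) (by omega)
  have hofR := evalC_ofReal hρ hab e hok
  have hnode : ∀ x ∈ gaussLegendreNodes (n + 1),
      ((b : ℝ) - a) / 2 * x + ((a : ℝ) + b) / 2 ∈ Set.Icc (a : ℝ) b := by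
    intro x hx
    have hxI := Literature.Analysis.SpecialFunctions.mem_Ioo_of_mem_gaussLegendreNodes hx
    constructor <;> nlinarith [hxI.1, hxI.2]
  have hint : ∫ t in (a : ℝ)..b, evalC e t = ∫ t in (a : ℝ)..b, ((evalR e t : ℝ) : ℂ) := by
    refine intervalIntegral.integral_congr (fun t ht => ?_)
    rw [Set.uIcc_of_le hab'.le] at ht
    exact hofR t ht
  have hsum : ∑ x ∈ gaussLegendreNodes (n + 1),
      (((b : ℝ) : ℂ) - ((a : ℝ) : ℂ)) / 2 * ((gaussLegendreWeight (n + 1) x : ℝ) : ℂ) *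
        evalC e ((((b : ℝ) : ℂ) - ((a : ℝ) : ℂ)) / 2 * (x : ℂ) + (((a : ℝ) : ℂ) + ((b : ℝ) : ℂ)) / 2) =
      ∑ x ∈ gaussLegendreNodes (n + 1),
        ((((b : ℝ) - a) / 2 * gaussLegendreWeight (n + 1) x *
          evalR e (((b : ℝ) - a) / 2 * x + ((a : ℝ) + b) / 2) : ℝ) : ℂ) := by
    refine Finset.sum_congr rfl (fun x hx => ?_)
    have h1 : (((b : ℝ) : ℂ) - ((a : ℝ) : ℂ)) / 2 * (x : ℂ) + (((a : ℝ) : ℂ) + ((b : ℝ) : ℂ)) / 2 =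
        (((((b : ℝ) - a) / 2 * x + ((a : ℝ) + b) / 2 : ℝ)) : ℂ) := by
      push_cast
      ring
    rw [h1, hofR _ (hnode x hx)]
    push_cast
    ring
  have hC : (((∫ t in (a : ℝ)..b, evalR e t) - ∑ x ∈ gaussLegendreNodes (n + 1),
        ((b : ℝ) - a) / 2 * gaussLegendreWeight (n + 1) x *
          evalR e (((b : ℝ) - a) / 2 * x + ((a : ℝ) + b) / 2) : ℝ) : ℂ) =
      (∫ t in (a : ℝ)..b, evalC e t) - ∑ x ∈ gaussLegendreNodes (n + 1),
        (((b : ℝ) : ℂ) - ((a : ℝ) : ℂ)) / 2 * ((gaussLegendreWeight (n + 1) x : ℝ) : ℂ) *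
          evalC e ((((b : ℝ) : ℂ) - ((a : ℝ) : ℂ)) / 2 * (x : ℂ) +
            (((a : ℝ) : ℂ) + ((b : ℝ) : ℂ)) / 2) := by
    rw [hsum, hint, intervalIntegral.integral_ofReal]
    push_cast
    rfl
  rw [← Real.norm_eq_abs, ← Complex.norm_real, hC]
  simpa using key


/-! ### Part D. The interval kernel: certified nodes and weights, the quadrature sum, the certificate -/

/-- A rational as an interval at scale `S`. [folklore] -/
def ofRat (S : ℕ) (q : ℚ) : MI := MI.ofFrac S q.num q.den

/-- Soundness of `ofRat` (a degenerate interval, outward rounded). [cite: Moore1979, Thm. 3.1] -/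
theorem mem_ofRat (S : ℕ) (q : ℚ) : MI.mem S (q : ℝ) (ofRat S q) := by
  rw [Rat.cast_def]
  exact MI.mem_ofFrac S q.num q.den_pos

/-- `(P_{k+1}(X), P_k(X))` by Bonnet's three-term recursion
`(k+2) P_{k+2} = (2k+3) x P_{k+1} − (k+1) P_k` in interval arithmetic at scale `S` — the evaluation
of `P_n` "by the recurrence in ball arithmetic" of the rigorous node computation.
[cite: Jeffrey1995, §18.2.5.1 (1)] [cite: JohanssonMezzarobba2018, Sect. 7.2] -/
def legPair (S : ℕ) (X : MI) : ℕ → MI × MI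
  | 0 => (X, MI.ofInt S 1)
  | k + 1 =>
    let p := legPair S X k
    ((((MI.mul S X p.1).mulInt (2 * (k : ℤ) + 3)).sub (p.2.mulInt ((k : ℤ) + 1))).divNat (k + 2), p.1)

/-- Soundness of `legPair`. [cite: Moore1979, Thm. 3.1] [cite: Jeffrey1995, §18.2.5.1 (1)] -/
theorem mem_legPair {S : ℕ} (hS : 0 < S) {x : ℝ} {X : MI} (hx : MI.mem S x X) :
    ∀ k : ℕ, MI.mem S ((legendre (k + 1)).eval x) (legPair S X k).1 ∧
      MI.mem S ((legendre k).eval x) (legPair S X k).2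
  | 0 => by
    refine ⟨?_, ?_⟩
    · simp only [legPair, Nat.zero_add, Literature.Analysis.SpecialFunctions.legendre_one,
        Polynomial.eval_X]
      exact hx
    · simp only [legPair, Literature.Analysis.SpecialFunctions.legendre_zero, Polynomial.eval_one]
      exact_mod_cast MI.mem_ofInt S 1
  | k + 1 => by
    obtain ⟨h1, h0⟩ := mem_legPair hS hx k
    refine ⟨?_, by simpa only [legPair] using h1⟩
    have h := MI.mem_divNat (MI.mem_sub (MI.mem_mulInt (MI.mem_mul hS hx h1) (2 * (k : ℤ) + 3))
      (MI.mem_mulInt h0 ((k : ℤ) + 1))) (n := k + 2) (by omega)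
    simp only [legPair]
    convert h using 2
    have hb := Literature.Analysis.SpecialFunctions.eval_legendre_add_two k x
    rw [eq_div_iff (by positivity)]
    push_cast
    linear_combination hb

/-- Natural powers of an interval. [cite: Moore1979, Sect. 3.3] -/
def powI (S : ℕ) (A : MI) : ℕ → MI
  | 0 => MI.ofInt S 1
  | n + 1 => MI.mul S (powI S A n) A

/-- Soundness of `powI`. [cite: Moore1979, Thm. 3.1] -/
theorem mem_powI {S : ℕ} (hS : 0 < S) {x : ℝ} {A : MI} (hx : MI.mem S x A) :
    ∀ n : ℕ, MI.mem S (x ^ n) (powI S A n)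
  | 0 => by simpa [powI] using MI.mem_ofInt S 1
  | n + 1 => by
    rw [pow_succ]
    exact MI.mem_mul hS (mem_powI hS hx n) hx

/-- **The interval evaluator** of the integrand at a real point: from `tI ∋ t` (scale `S`, Taylor
parameters `K, k`, an enclosure `piI ∋ π` for the argument reduction of `cos`, `sin`) an enclosure
of `f(t)` (`none` if a reciprocal or square root cannot be certified or a kernel declines).
[cite: Moore1979, Sect. 4.4 (4.12)] -/
def evalI (S K k : ℕ) (piI tI : MI) : EExpr → Option MI
  | .var => some tI
  | .const c => some (ofRat S c)
  | .scale q e =>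
    match evalI S K k piI tI e with
    | some A => some (MI.mul S (ofRat S q) A)
    | none => none
  | .add e f =>
    match evalI S K k piI tI e, evalI S K k piI tI f with
    | some A, some B => some (A.add B)
    | _, _ => none
  | .sub e f =>
    match evalI S K k piI tI e, evalI S K k piI tI f with
    | some A, some B => some (A.sub B)
    | _, _ => none
  | .neg e =>
    match evalI S K k piI tI e with
    | some A => some A.neg
    | none => none
  | .mul e f =>
    match evalI S K k piI tI e, evalI S K k piI tI f with
    | some A, some B => some (MI.mul S A B)
    | _, _ => none
  | .pow e n =>
    match evalI S K k piI tI e with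
    | some A => some (powI S A n)
    | none => none
  | .exp e =>
    match evalI S K k piI tI e with
    | some A => MI.exp S K k A
    | none => none
  | .cos e =>
    match evalI S K k piI tI e with
    | some A =>
      match MC.expI S K k piI A with
      | some W => some W.re
      | none => none
    | none => none
  | .sin e =>
    match evalI S K k piI tI e with
    | some A =>
      match MC.expI S K k piI A with
      | some W => some W.im
      | none => none
    | none => none
  | .inv e =>
    match evalI S K k piI tI e with
    | some A => invI S A
    | none => none
  | .sqrt e =>
    match evalI S K k piI tI e with
    | some A => sqrtI S A
    | none => none

/-- **Soundness of the interval evaluator.** [cite: Moore1979, Thm. 3.1] -/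
theorem mem_evalI {S K k : ℕ} (hS : 0 < S) {piI : MI} (hpi : MI.mem S Real.pi piI) {t : ℝ}
    {tI : MI} (ht : MI.mem S t tI) :
    ∀ (e : EExpr) {Y : MI}, evalI S K k piI tI e = some Y → MI.mem S (evalR e t) Y := by
  intro e
  induction e with
  | var =>
    intro Y h
    simp only [evalI, Option.some.injEq] at h
    subst h
    simpa [evalR] using ht
  | const c =>
    intro Y h
    simp only [evalI, Option.some.injEq] at h
    subst h
    simpa [evalR] using mem_ofRat S c
  | scale q e ih =>
    intro Y h
    simp only [evalI] at h
    split at h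
    · rename_i A hA
      simp only [Option.some.injEq] at h
      subst h
      simpa [evalR] using MI.mem_mul hS (mem_ofRat S q) (ih hA)
    · simp at h
  | add e f ihe ihf =>
    intro Y h
    simp only [evalI] at h
    split at h
    · rename_i A B hA hB
      simp only [Option.some.injEq] at h
      subst h
      exact MI.mem_add (ihe hA) (ihf hB)
    · simp at h
  | sub e f ihe ihf =>
    intro Y h
    simp only [evalI] at h
    split at h
    · rename_i A B hA hB
      simp only [Option.some.injEq] at h
      subst h
      exact MI.mem_sub (ihe hA) (ihf hB)
    · simp at h
  | neg e ih =>
    intro Y h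
    simp only [evalI] at h
    split at h
    · rename_i A hA
      simp only [Option.some.injEq] at h
      subst h
      exact MI.mem_neg (ih hA)
    · simp at h
  | mul e f ihe ihf =>
    intro Y h
    simp only [evalI] at h
    split at h
    · rename_i A B hA hB
      simp only [Option.some.injEq] at h
      subst h
      exact MI.mem_mul hS (ihe hA) (ihf hB)
    · simp at h
  | pow e n ih =>
    intro Y h
    simp only [evalI] at h
    split at h
    · rename_i A hA
      simp only [Option.some.injEq] at h
      subst h
      exact mem_powI hS (ih hA) n
    · simp at h
  | exp e ih =>
    intro Y h
    simp only [evalI] at h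
    split at h
    · rename_i A hA
      exact MI.mem_exp hS h (ih hA)
    · simp at h
  | cos e ih =>
    intro Y h
    simp only [evalI] at h
    split at h
    · rename_i A hA
      split at h
      · rename_i W hW
        simp only [Option.some.injEq] at h
        subst h
        have h1 := (MC.mem_expI hS hpi hW (ih hA)).1
        rw [Complex.exp_ofReal_mul_I_re] at h1
        simpa [evalR] using h1
      · simp at h
    · simp at h
  | sin e ih =>
    intro Y h
    simp only [evalI] at h
    split at h
    · rename_i A hA
      split at h
      · rename_i W hW
        simp only [Option.some.injEq] at h
        subst h
        have h1 := (MC.mem_expI hS hpi hW (ih hA)).2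
        rw [Complex.exp_ofReal_mul_I_im] at h1
        simpa [evalR] using h1
      · simp at h
    · simp at h
  | inv e ih =>
    intro Y h
    simp only [evalI] at h
    split at h
    · rename_i A hA
      exact mem_invI hS h (ih hA)
    · simp at h
  | sqrt e ih =>
    intro Y h
    simp only [evalI] at h
    split at h
    · rename_i A hA
      exact mem_sqrtI hS h (ih hA)
    · simp at h

/-- **Exact integer Legendre values at a rational point**: `legInt T c k = (R_{k+1}, R_k)` with
`R_k = T^k · k! · P_k(c/T) ∈ ℤ`, by Bonnet's recursion cleared of denominators,
`R_{k+2} = (2k+3)·c·R_{k+1} − (k+1)²·T²·R_k` — the SIGN of `P_{n+1}` at a bracket end is read off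
exactly (no rounding), three integer operations per degree.
[cite: Jeffrey1995, §18.2.5.1 (1)] [cite: Szego1939, Thm. 3.3.1] -/
def legInt (T c : ℤ) : ℕ → ℤ × ℤ
  | 0 => (c, 1)
  | k + 1 =>
    let p := legInt T c k
    ((2 * (k : ℤ) + 3) * c * p.1 - ((k : ℤ) + 1) ^ 2 * T ^ 2 * p.2, p.1)

/-- `legInt` computes `T^{k} k! P_k(c/T)` exactly. [cite: Jeffrey1995, §18.2.5.1 (1)] -/
theorem legInt_eq {T : ℤ} (hT : T ≠ 0) (c : ℤ) :
    ∀ k : ℕ, ((legInt T c k).1 : ℝ) =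
        (T : ℝ) ^ (k + 1) * ((k + 1).factorial : ℝ) * (legendre (k + 1)).eval ((c : ℝ) / T) ∧
      ((legInt T c k).2 : ℝ) = (T : ℝ) ^ k * (k.factorial : ℝ) * (legendre k).eval ((c : ℝ) / T)
  | 0 => by
    have hT' : (T : ℝ) ≠ 0 := by exact_mod_cast hT
    refine ⟨?_, ?_⟩
    · simp only [legInt, Nat.zero_add, Literature.Analysis.SpecialFunctions.legendre_one,
        Polynomial.eval_X, Nat.factorial_one, pow_one, Nat.cast_one, mul_one]
      field_simp
    · simp [legInt, Literature.Analysis.SpecialFunctions.legendre_zero]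
  | k + 1 => by
    have hT' : (T : ℝ) ≠ 0 := by exact_mod_cast hT
    obtain ⟨h1, h0⟩ := legInt_eq hT c k
    refine ⟨?_, by simpa only [legInt] using h1⟩
    have hb := Literature.Analysis.SpecialFunctions.eval_legendre_add_two k ((c : ℝ) / T)
    set x : ℝ := (c : ℝ) / T with hx
    have hc : (c : ℝ) = x * T := by rw [hx]; field_simp
    simp only [legInt]
    push_cast
    rw [h1, h0, Nat.factorial_succ (k + 1), Nat.factorial_succ k]
    push_cast
    rw [hc]
    linear_combination (-((x * (T : ℝ)) ^ 0 * (T : ℝ) ^ (k + 2) * ((k : ℝ) + 1) *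
      (k.factorial : ℝ))) * hb

/-- The sign of `P_{k+1}(c/T)` is the sign of `(legInt T c k).1` (`T > 0`): negative case.
[cite: Jeffrey1995, §18.2.5.1 (1)] -/
theorem eval_legendre_neg_of_legInt {T : ℤ} (hT : 0 < T) {c : ℤ} {k : ℕ}
    (h : (legInt T c k).1 < 0) : (legendre (k + 1)).eval ((c : ℝ) / T) < 0 := by
  have h1 := (legInt_eq hT.ne' c k).1
  have hlt : ((legInt T c k).1 : ℝ) < 0 := by exact_mod_cast h
  rw [h1] at hlt
  have hpos : (0 : ℝ) < (T : ℝ) ^ (k + 1) * ((k + 1).factorial : ℝ) := by positivity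
  by_contra hge
  exact absurd hlt (not_lt.mpr (mul_nonneg hpos.le (not_lt.mp hge)))

/-- The sign of `P_{k+1}(c/T)` is the sign of `(legInt T c k).1` (`T > 0`): positive case.
[cite: Jeffrey1995, §18.2.5.1 (1)] -/
theorem eval_legendre_pos_of_legInt {T : ℤ} (hT : 0 < T) {c : ℤ} {k : ℕ}
    (h : 0 < (legInt T c k).1) : 0 < (legendre (k + 1)).eval ((c : ℝ) / T) := by
  have h1 := (legInt_eq hT.ne' c k).1
  have hlt : (0 : ℝ) < ((legInt T c k).1 : ℝ) := by exact_mod_cast h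
  rw [h1] at hlt
  have hpos : (0 : ℝ) < (T : ℝ) ^ (k + 1) * ((k + 1).factorial : ℝ) := by positivity
  by_contra hle
  exact absurd hlt (not_lt.mpr (mul_nonpos_iff.mpr (Or.inl ⟨hpos.le, not_lt.mp hle⟩)))

/-- The working scale of the interval Legendre evaluation on a bracket of width `2/T`: ten guard
bits over `T` (the bracket width, not the rounding, then dominates the enclosure). [folklore] -/
def bscale (T : ℕ) : ℕ := T * 1024

/-- **One term of the rule from one node candidate.**  The candidate `c` names the bracket
`[(c−1)/T, (c+1)/T]`; the term is `none` unless `P_{n+1}` has opposite signs at the two bracket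
ends (decided EXACTLY by `legInt`), in which case the bracket contains a node `x` of the
`(n+1)`-point rule, its weight is enclosed by the formula `λ_x = 2(1 − x²)/((n+1)² P_n(x)²)`
evaluated on the bracket (`legPair` at scale `bscale T`), and the term
`(b−a)/2 · λ_x · f((b−a)/2·x + (a+b)/2)` is enclosed at scale `S`.
[cite: Szego1939, Thm. 3.3.1] [cite: AbramowitzStegun1964, 25.4.29]
[cite: JohanssonMezzarobba2018, Sect. 7.2] -/
def glTerm (e : EExpr) (a b : ℚ) (n S T K k : ℕ) (piI : MI) (c : ℤ) : Option MI :=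
  let RA := (legInt T (c - 1) n).1
  let RB := (legInt T (c + 1) n).1
  if (RA < 0 ∧ 0 < RB) ∨ (0 < RA ∧ RB < 0) then
    let SP := bscale T
    let X : MI := MI.span (MI.ofFrac SP (c - 1) T) (MI.ofFrac SP (c + 1) T)
    match MI.divPos SP (((MI.ofInt SP 1).sub (MI.sqr SP X)).mulInt 2)
        ((MI.sqr SP (legPair SP X n).2).mulInt (((n : ℤ) + 1) ^ 2)) with
    | none => none
    | some W =>
      match evalI S K k piI
          ((MI.mul S (ofRat S ((b - a) / 2)) (MI.rescale SP S X)).add (ofRat S ((a + b) / 2))) e with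
      | none => none
      | some F => some (MI.mul S (MI.mul S (ofRat S ((b - a) / 2)) (MI.rescale SP S W)) F)
  else none

/-- **Soundness of `glTerm`.**  A `some` answer certifies the sign change of `P_{n+1}` across the
bracket and encloses the term of every node in the bracket. [cite: Szego1939, Thm. 3.3.1]
[cite: AbramowitzStegun1964, 25.4.29] [cite: Moore1979, Thm. 3.1] -/
theorem glTerm_spec {e : EExpr} {a b : ℚ} {n S T K k : ℕ} {piI : MI} {c : ℤ} {Y : MI}
    (hS : 0 < S) (hT : 0 < T) (hpi : MI.mem S Real.pi piI)
    (h : glTerm e a b n S T K k piI c = some Y) :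
    (legendre (n + 1)).eval ((((c - 1 : ℤ)) : ℝ) / T) *
        (legendre (n + 1)).eval ((((c + 1 : ℤ)) : ℝ) / T) < 0 ∧
      ∀ x ∈ gaussLegendreNodes (n + 1), (((c - 1 : ℤ)) : ℝ) / T ≤ x → x ≤ (((c + 1 : ℤ)) : ℝ) / T →
        MI.mem S (((b : ℝ) - a) / 2 * gaussLegendreWeight (n + 1) x *
          evalR e (((b : ℝ) - a) / 2 * x + ((a : ℝ) + b) / 2)) Y := by
  have hSP : 0 < bscale T := by unfold bscale; omega
  have hTz : (0 : ℤ) < (T : ℤ) := by exact_mod_cast hT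
  have hXA : MI.mem (bscale T) ((((c - 1 : ℤ)) : ℝ) / T) (MI.ofFrac (bscale T) (c - 1) T) :=
    MI.mem_ofFrac _ _ hT
  have hXB : MI.mem (bscale T) ((((c + 1 : ℤ)) : ℝ) / T) (MI.ofFrac (bscale T) (c + 1) T) :=
    MI.mem_ofFrac _ _ hT
  unfold glTerm at h
  simp only at h
  split_ifs at h with hsgn
  split at h
  · simp at h
  rename_i W hW
  split at h
  · simp at h
  rename_i F hF
  simp only [Option.some.injEq] at h
  subst h
  refine ⟨?_, ?_⟩
  · have eA : ((((c - 1 : ℤ)) : ℝ) / T) = (((c - 1 : ℤ) : ℝ) / ((T : ℤ) : ℝ)) := by norm_cast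
    have eB : ((((c + 1 : ℤ)) : ℝ) / T) = (((c + 1 : ℤ) : ℝ) / ((T : ℤ) : ℝ)) := by norm_cast
    rw [eA, eB]
    rcases hsgn with ⟨h1, h2⟩ | ⟨h1, h2⟩
    · exact mul_neg_of_neg_of_pos (eval_legendre_neg_of_legInt hTz h1)
        (eval_legendre_pos_of_legInt hTz h2)
    · exact mul_neg_of_pos_of_neg (eval_legendre_pos_of_legInt hTz h1)
        (eval_legendre_neg_of_legInt hTz h2)
  · intro x hx hαx hxβ
    have hxX : MI.mem (bscale T) x
        (MI.span (MI.ofFrac (bscale T) (c - 1) T) (MI.ofFrac (bscale T) (c + 1) T)) :=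
      MI.mem_span hXA hXB hαx hxβ
    have hPn := (mem_legPair hSP hxX n).2
    have hnum := MI.mem_mulInt (MI.mem_sub (MI.mem_ofInt (bscale T) 1) (MI.mem_sqr hSP hxX)) 2
    have hden := MI.mem_mulInt (MI.mem_sqr hSP hPn) (((n : ℤ) + 1) ^ 2)
    have hw := MI.mem_divPos hSP hW hnum hden
    have hweq : ((1 : ℤ) - x ^ 2) * ((2 : ℤ) : ℝ) /
        (((legendre n).eval x) ^ 2 * (((((n : ℤ) + 1) ^ 2 : ℤ)) : ℝ)) =
          gaussLegendreWeight (n + 1) x := by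
      rw [Literature.Analysis.SpecialFunctions.gaussLegendreWeight_eq_of_legendre_pred hx]
      push_cast
      ring
    rw [hweq] at hw
    have hwS := MI.mem_rescale hSP S hw
    have hxS := MI.mem_rescale hSP S hxX
    have htI := MI.mem_add (MI.mem_mul hS (mem_ofRat S ((b - a) / 2)) hxS) (mem_ofRat S ((a + b) / 2))
    have hteq : ((((b - a) / 2 : ℚ)) : ℝ) * x + ((((a + b) / 2 : ℚ)) : ℝ) =
        ((b : ℝ) - a) / 2 * x + ((a : ℝ) + b) / 2 := by
      push_cast
      ring
    rw [hteq] at htI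
    have hF' := mem_evalI hS hpi htI e hF
    have hterm := MI.mem_mul hS (MI.mem_mul hS (mem_ofRat S ((b - a) / 2)) hwS) hF'
    convert hterm using 2
    push_cast
    ring

/-- The folded quadrature sum over the first `j` node candidates (`cs.getD i 0`, `i < j`).
[cite: Petras2002, Sect. 3 (2)] -/
def glSum (e : EExpr) (a b : ℚ) (n S T K k : ℕ) (piI : MI) (cs : List ℤ) : ℕ → Option MI
  | 0 => some (MI.ofInt S 0)
  | j + 1 =>
    match glSum e a b n S T K k piI cs j, glTerm e a b n S T K k piI (cs.getD j 0) with
    | some acc, some Y => some (acc.add Y)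
    | _, _ => none

/-- Soundness of `glSum`: every term was certified, and the sum of any real family enclosed
termwise is enclosed. [cite: Moore1979, Thm. 3.1] -/
theorem glSum_spec {e : EExpr} {a b : ℚ} {n S T K k : ℕ} {piI : MI} {cs : List ℤ} :
    ∀ (j : ℕ) {Sg : MI}, glSum e a b n S T K k piI cs j = some Sg →
      (∀ i < j, ∃ Y, glTerm e a b n S T K k piI (cs.getD i 0) = some Y) ∧
        ∀ v : ℕ → ℝ, (∀ i < j, ∀ Y, glTerm e a b n S T K k piI (cs.getD i 0) = some Y →
          MI.mem S (v i) Y) → MI.mem S (∑ i ∈ Finset.range j, v i) Sg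
  | 0 => by
    intro h
    simp only [glSum, Option.some.injEq] at h
    subst h
    refine ⟨fun i hi => absurd hi (Nat.not_lt_zero i), fun v _ => ?_⟩
    simpa using MI.mem_ofInt S 0
  | j + 1 => by
    intro h
    simp only [glSum] at h
    split at h
    · rename_i acc Y hacc hY
      simp only [Option.some.injEq] at h
      subst h
      obtain ⟨hex, hmem⟩ := glSum_spec j hacc
      refine ⟨fun i hi => ?_, fun v hv => ?_⟩
      · rcases Nat.lt_succ_iff_lt_or_eq.mp hi with hlt | heq
        · exact hex i hlt
        · subst heq; exact ⟨Y, hY⟩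
      · rw [Finset.sum_range_succ]
        exact MI.mem_add (hmem v (fun i hi Y' hY' => hv i (Nat.lt_succ_of_lt hi) Y' hY'))
          (hv j (Nat.lt_succ_self j) Y hY)
    · simp at h

/-- The certified error radius `(b−a)/2 · 8·ub/((ρ − 1) ρ^{2n+1})` as a rational.
[cite: Trefethen2008, Thm. 4.5] -/
def errQ (e : EExpr) (a b ρ : ℚ) (n : ℕ) : ℚ :=
  (b - a) / 2 * (8 * (ebnd ρ a b e).ub / ((ρ - 1) * ρ ^ (2 * (n + 1) - 1)))

/-- The certificate data: the enclosure `Sg ∋ Q·S` of the rule's value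
`Q = Σ (b−a)/2·λ_x·f((b−a)/2·x + (a+b)/2)` and `E ∋ errQ·S` of the error radius (`none` if `π` or a
term cannot be enclosed) — `#eval` it to choose `lo, hi`. [cite: Petras2002, Sect. 3 (2)] -/
def glData (e : EExpr) (a b ρ : ℚ) (n S T K k : ℕ) (cs : List ℤ) : Option (MI × MI) :=
  match MI.pi S K with
  | none => none
  | some piI =>
    match glSum e a b n S T K k piI cs (n + 1) with
    | none => none
    | some Sg => some (Sg, ofRat S (errQ e a b ρ n))

/-- **The certificate (data form).**  `glCheckD e a b ρ n S T K k cs lo hi` checks, by integer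
arithmetic only: `ρ > 1`, `a < b`, the side conditions `eok ρ a b e`, `S, T > 0`, that the
`n+1` node candidates `cs` (numerators at scale `T`, ascending) are separated (`cᵢ + 2 < cᵢ₊₁`, so the
brackets `[(cᵢ−1)/T, (cᵢ+1)/T]` are pairwise disjoint), that every bracket passes `glTerm` (certified
sign change of `P_{n+1}`, enclosed weight and integrand value), and that the resulting quadrature
sum `± errQ` computed at scale `S` lies inside `[lo, hi]`.  One step of the Petras–Johansson
rigorous integrator (one ellipse, one degree, no bisection), with the nodes certified rather than
tabulated. [cite: Petras2002, Sect. 3 (2)] [cite: Johansson2018, Sect. 2] -/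
def glCheckD (e : EExpr) (a b ρ : ℚ) (n S T K k : ℕ) (cs : List ℤ) (lo hi : ℚ) : Bool :=
  decide (1 < ρ) && decide (a < b) && eok ρ a b e && decide (0 < S) &&
    decide (0 < T) && decide (∀ j < n, cs.getD j 0 + 2 < cs.getD (j + 1) 0) &&
    match glData e a b ρ n S T K k cs with
    | none => false
    | some D =>
      decide (lo.num * (S : ℤ) ≤ (D.1.lo - D.2.hi) * (lo.den : ℤ)) &&
        decide ((D.1.hi + D.2.hi) * (hi.den : ℤ) ≤ hi.num * (S : ℤ))

/-- Separated consecutive candidates are pairwise separated. [folklore] -/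
private theorem sep_of_chain {c : ℕ → ℤ} {n : ℕ} (h : ∀ j < n, c j + 2 < c (j + 1)) :
    ∀ i j : ℕ, i < j → j ≤ n → c i + 2 < c j := by
  intro i j hij hjn
  induction j with
  | zero => exact absurd hij (Nat.not_lt_zero i)
  | succ j ih =>
    rcases Nat.lt_succ_iff_lt_or_eq.mp hij with hlt | heq
    · have h1 := ih hlt (by omega)
      have h2 := h j (by omega)
      linarith
    · subst heq
      linarith [h i (by omega)]

/-- **Kernel-checked enclosure of `∫ₐᵇ f(t) dt` by Gauss–Legendre quadrature.**  One `decide` of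
`glCheckD` proves `∫ₐᵇ evalR e t dt ∈ [lo, hi]`: the brackets certify exactly the `n+1` nodes of the
rule (`existsUnique_gaussLegendreNode_mem_Icc`, `exists_gaussLegendreNode_mem_Ioo`: one node in
each bracket and no node outside), so the interval sum encloses the rule's value, and Part C bounds
its distance to the integral. [cite: Trefethen2008, Thm. 4.5] [cite: Petras2002, Sect. 3 (2)]
[cite: Johansson2018, Sect. 2] [cite: Szego1939, Thm. 3.3.1] -/
theorem integral_mem_of_glCheckD {e : EExpr} {a b ρ : ℚ} {n S T K k : ℕ} {cs : List ℤ}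
    {lo hi : ℚ} (h : glCheckD e a b ρ n S T K k cs lo hi = true) :
    (∫ t in (a : ℝ)..b, evalR e t) ∈ Set.Icc (lo : ℝ) hi := by
  unfold glCheckD at h
  simp only [Bool.and_eq_true, decide_eq_true_eq] at h
  obtain ⟨⟨⟨⟨⟨⟨hρ, hab⟩, hok⟩, hS⟩, hT⟩, hsep⟩, hrest⟩ := h
  split at hrest
  · simp at hrest
  rename_i D hD
  simp only [Bool.and_eq_true, decide_eq_true_eq] at hrest
  obtain ⟨h1, h2⟩ := hrest
  unfold glData at hD
  split at hD
  · simp at hD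
  rename_i piI hpiEq
  split at hD
  · simp at hD
  rename_i Sg hSg
  simp only [Option.some.injEq] at hD
  subst hD
  dsimp only at h1 h2
  have hSr : (0 : ℝ) < S := by exact_mod_cast hS
  have hTr : (0 : ℝ) < T := by exact_mod_cast hT
  have hpi := MI.mem_pi S hpiEq
  obtain ⟨hterms, hsumMem⟩ := glSum_spec (n + 1) hSg
  -- the brackets
  set α : Fin (n + 1) → ℝ := fun i => (((cs.getD i 0 - 1 : ℤ)) : ℝ) / T with hαdef
  set β : Fin (n + 1) → ℝ := fun i => (((cs.getD i 0 + 1 : ℤ)) : ℝ) / T with hβdef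
  have hαβ : ∀ i, α i ≤ β i := by
    intro i
    simp only [hαdef, hβdef]
    push_cast
    exact div_le_div_of_nonneg_right (by linarith) hTr.le
  have hsign : ∀ i, (legendre (n + 1)).eval (α i) * (legendre (n + 1)).eval (β i) < 0 := by
    intro i
    obtain ⟨Y, hY⟩ := hterms i i.2
    exact (glTerm_spec hS hT hpi hY).1
  have hdisj : Pairwise fun i j => Disjoint (Set.Icc (α i) (β i)) (Set.Icc (α j) (β j)) := by
    have hsep' := sep_of_chain (c := fun j => cs.getD j 0) hsep
    have hlt : ∀ i j : Fin (n + 1), (i : ℕ) < j → β i < α j := by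
      intro i j hij
      have h3 : cs.getD i 0 + 2 < cs.getD j 0 := hsep' i j hij (by omega)
      simp only [hαdef, hβdef]
      push_cast
      have h4 : ((cs.getD i 0 : ℤ) : ℝ) + 2 < ((cs.getD j 0 : ℤ) : ℝ) := by exact_mod_cast h3
      exact div_lt_div_of_pos_right (by linarith) hTr
    intro i j hne
    rcases lt_or_gt_of_ne (Fin.val_ne_of_ne hne) with hij | hji
    · exact Set.disjoint_left.mpr fun x hx hx' => by linarith [hx.2, hx'.1, hlt i j hij]
    · exact Set.disjoint_left.mpr fun x hx hx' => by linarith [hx.1, hx'.2, hlt j i hji]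
  have hcard : Fintype.card (Fin (n + 1)) = n + 1 := Fintype.card_fin _
  have hex := existsUnique_gaussLegendreNode_mem_Icc hcard hαβ hsign hdisj
  -- the node of each bracket
  have hξex : ∀ i, ∃ x, x ∈ Set.Icc (α i) (β i) ∧ x ∈ gaussLegendreNodes (n + 1) :=
    fun i => (hex i).exists
  choose ξ hξ using hξex
  set G : ℝ → ℝ := fun x => ((b : ℝ) - a) / 2 * gaussLegendreWeight (n + 1) x *
    evalR e (((b : ℝ) - a) / 2 * x + ((a : ℝ) + b) / 2) with hGdef
  have hsumEq : ∑ i : Fin (n + 1), G (ξ i) = ∑ x ∈ gaussLegendreNodes (n + 1), G x := by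
    refine Finset.sum_nbij ξ (fun i _ => ?_) (fun i _ j _ hij => ?_) (fun x hx => ?_) (fun _ _ => rfl)
    · exact (hξ i).2
    · by_contra hne
      have hd := hdisj hne
      exact Set.disjoint_left.mp hd (hξ i).1 (hij ▸ (hξ j).1)
    · have hx' : x ∈ gaussLegendreNodes (n + 1) := by exact_mod_cast hx
      obtain ⟨i, hi⟩ := exists_gaussLegendreNode_mem_Ioo hcard hαβ hsign hdisj hx'
      refine ⟨i, by simp, ?_⟩
      exact (hex i).unique (hξ i) ⟨Set.Ioo_subset_Icc_self hi, hx'⟩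
  -- the interval sum encloses the rule
  set v : ℕ → ℝ := fun j => if hj : j < n + 1 then G (ξ ⟨j, hj⟩) else 0 with hvdef
  have hvmem : MI.mem S (∑ j ∈ Finset.range (n + 1), v j) Sg := by
    refine hsumMem v (fun j hj Y hY => ?_)
    have hb := (hξ ⟨j, hj⟩).1
    simp only [hαdef, hβdef, Set.mem_Icc] at hb
    have hspec := (glTerm_spec hS hT hpi hY).2 (ξ ⟨j, hj⟩) (hξ ⟨j, hj⟩).2 hb.1 hb.2
    have hvj : v j = G (ξ ⟨j, hj⟩) := by simp only [hvdef, dif_pos hj]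
    rw [hvj, hGdef]
    exact hspec
  have hvG : ∑ j ∈ Finset.range (n + 1), v j = ∑ x ∈ gaussLegendreNodes (n + 1), G x := by
    rw [← hsumEq, Finset.sum_range]
    refine Finset.sum_congr rfl (fun i _ => ?_)
    simp only [hvdef, dif_pos i.2]
  rw [hvG] at hvmem
  -- the real quantities
  set Q : ℝ := ∑ x ∈ gaussLegendreNodes (n + 1), G x with hQdef
  set I : ℝ := ∫ t in (a : ℝ)..b, evalR e t with hIdef
  set ε : ℝ := ((b : ℝ) - a) / 2 *
    (8 * ((ebnd ρ a b e).ub : ℝ) / (((ρ : ℝ) - 1) * (ρ : ℝ) ^ (2 * (n + 1) - 1))) with hε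
  have habs : |I - Q| ≤ ε := by
    have := abs_integral_sub_gl_le hρ hab hok n
    simpa only [hIdef, hQdef, hGdef, hε] using this
  rw [abs_le] at habs
  have herr : MI.mem S ε (ofRat S (errQ e a b ρ n)) := by
    have := mem_ofRat S (errQ e a b ρ n)
    convert this using 2
    rw [hε, errQ]
    push_cast
    ring
  obtain ⟨hA1, hA2⟩ := hvmem
  obtain ⟨hB1, hB2⟩ := herr
  have h1r : (lo.num : ℝ) * S ≤ ((Sg.lo : ℝ) - (ofRat S (errQ e a b ρ n)).hi) * lo.den := by
    exact_mod_cast h1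
  have h2r : ((Sg.hi : ℝ) + (ofRat S (errQ e a b ρ n)).hi) * hi.den ≤ hi.num * S := by
    exact_mod_cast h2
  have hdlo : (0 : ℝ) < lo.den := by exact_mod_cast lo.den_pos
  have hdhi : (0 : ℝ) < hi.den := by exact_mod_cast hi.den_pos
  constructor
  · have keylo : (lo.num : ℝ) * S ≤ I * lo.den * S := by
      calc (lo.num : ℝ) * S ≤ ((Sg.lo : ℝ) - (ofRat S (errQ e a b ρ n)).hi) * lo.den := h1r
        _ ≤ (Q - ε) * S * lo.den := by
            apply mul_le_mul_of_nonneg_right _ hdlo.le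
            linarith
        _ ≤ I * S * lo.den := by
            apply mul_le_mul_of_nonneg_right _ hdlo.le
            apply mul_le_mul_of_nonneg_right _ hSr.le
            linarith
        _ = I * lo.den * S := by ring
    have keylo' : (lo.num : ℝ) ≤ I * lo.den := le_of_mul_le_mul_right keylo hSr
    show (lo : ℝ) ≤ I
    rw [Rat.cast_def, div_le_iff₀ hdlo]
    exact keylo'
  · have keyhi : I * hi.den * S ≤ (hi.num : ℝ) * S := by
      calc I * hi.den * S = I * S * hi.den := by ring
        _ ≤ (Q + ε) * S * hi.den := by
            apply mul_le_mul_of_nonneg_right _ hdhi.le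
            apply mul_le_mul_of_nonneg_right _ hSr.le
            linarith
        _ ≤ ((Sg.hi : ℝ) + (ofRat S (errQ e a b ρ n)).hi) * hi.den := by
            apply mul_le_mul_of_nonneg_right _ hdhi.le
            linarith
        _ ≤ hi.num * S := h2r
    have keyhi' : I * hi.den ≤ (hi.num : ℝ) := le_of_mul_le_mul_right keyhi hSr
    show I ≤ (hi : ℝ)
    rw [Rat.cast_def, le_div_iff₀ hdhi]
    exact keyhi'

/-! #### Untrusted node candidates (any output is sound input to `glCheckD`; nothing is proved) -/

/-- Truncating fixed-point `(P_{k+1}(x), P_k(x))·U` for `x·U = xs` (UNTRUSTED helper of the node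
search). [cite: JohanssonMezzarobba2018, Sect. 7.2] -/
def legFix (U : ℕ) (xs : ℤ) : ℕ → ℤ × ℤ
  | 0 => (xs, (U : ℤ))
  | k + 1 =>
    let p := legFix U xs k
    (((2 * (k : ℤ) + 3) * (xs * p.1 / U) - ((k : ℤ) + 1) * p.2) / ((k : ℤ) + 2), p.1)

/-- Newton's iteration `x ← x − P_{n+1}(x)(1 − x²)/((n+1)(P_n(x) − x P_{n+1}(x)))` in fixed point at
scale `U`, `fuel` steps (UNTRUSTED). [cite: JohanssonMezzarobba2018, Sect. 7.2] -/
def glNewton (U n : ℕ) : ℕ → ℤ → ℤ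
  | 0, xs => xs
  | fuel + 1, xs =>
    let p := legFix U xs n
    let d := ((n : ℤ) + 1) * (p.2 - xs * p.1 / U)
    glNewton U n fuel (if d = 0 then xs else xs - p.1 * (((U : ℤ) * U - xs * xs) / U) / d)

/-- **Node candidates** for the `(n+1)`-point rule at scale `T` (ascending): Newton's method from
the Chebyshev-type initial guesses `cos(π(4i+3)/(4n+6))`, in truncating integer arithmetic with
`2n + 16` guard bits, rounded to scale `T` — UNTRUSTED (its output is only ever CHECKED, by
`glTerm`); evaluate with `#eval glCands n T` and paste the list into `glCheckD`, or call `glCheck`.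
[cite: JohanssonMezzarobba2018, Sect. 7.2] [cite: Petras2002, Sect. 5.1] -/
def glCands (n T : ℕ) : List ℤ :=
  let N := n + 1
  let U : ℕ := T * 2 ^ (2 * n + 16)
  let U0 : ℕ := 2 ^ 62
  let pi0 := MI.pi U0 30
  let guess : ℕ → ℤ := fun i =>
    match pi0 with
    | none => 0
    | some piI =>
      match MC.expI U0 30 6 piI ((piI.mulInt (4 * ((N - 1 - i : ℕ) : ℤ) + 3)).divNat (4 * N + 2)) with
      | none => 0
      | some E => (E.re.lo + E.re.hi) / 2 * U / U0
  (List.range N).map fun i =>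
    let xs := glNewton U n 12 (guess i)
    (2 * xs * T + U) / (2 * U)

/-- **The certificate (self-contained form)**: `glCheckD` with the node candidates `glCands n T`
computed inside the check (the kernel then also runs the Newton search: `12·(n+1)²` cheap integer
steps; `7 s` in all for `n = 24`, `S = 2¹⁵⁰`; for large `n` paste `#eval glCands n T` into `glCheckD`
instead). [cite: Petras2002, Sect. 3 (2)] -/
def glCheck (e : EExpr) (a b ρ : ℚ) (n S T K k : ℕ) (lo hi : ℚ) : Bool :=
  glCheckD e a b ρ n S T K k (glCands n T) lo hi

/-- **Kernel-checked enclosure of `∫ₐᵇ f(t) dt`, self-contained form.** [cite: Trefethen2008, Thm. 4.5]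
[cite: Petras2002, Sect. 3 (2)] [cite: Johansson2018, Sect. 2] -/
theorem integral_mem_of_glCheck {e : EExpr} {a b ρ : ℚ} {n S T K k : ℕ} {lo hi : ℚ}
    (h : glCheck e a b ρ n S T K k lo hi = true) :
    (∫ t in (a : ℝ)..b, evalR e t) ∈ Set.Icc (lo : ℝ) hi :=
  integral_mem_of_glCheckD h

end GaussLegendre

end Literature.Analysis.ValidatedNumerics
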